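import Literature.Barriers.AtomisticToContinuum.NoBVEstimatesMultiDExpansionLemmas
import Literature.Barriers.AtomisticToContinuum.NoBVEstimatesMultiDSmallAmplitude
import Mathlib.Algebra.Order.Chebyshev
import HarnessLib

/-!
# Rauch's `L²` small-amplitude expansion from small classical solutions: the remainder
`r_ε = u_ε - ū - εv` by Duhamel's principle on the Fourier side

Third brick of the programme to discharge `Rauch1986_smallAmplitudeExpansionL2`
(`NoBVEstimatesMultiDSmallAmplitude.lean`). The printed sentence is "`u_ε = ū + εv + r_ε`,
where `v` is the solution of the linearized equation (4), and for any `s > 0`,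
`sup_{0≤t≤t̄} ‖r_ε(t)‖_{Hˢ(ℝᵈ)} = O(ε²)`. In particular, `‖∇ₓr_ε(t̄)‖_{L²(ℝᵈ)} = O(ε²)`"
[Rauch1986, Proof of Theorem p. 482], quoted from the Local Existence Theorem with its smooth
dependence on the data. This file proves the `L²` remainder bound for ANY family of classical
solutions `u_ε` of (1) on `[0, T]` with data `ū + εφ` that is `C²` on the slab, equal to `ū`
off a fixed ball, and `O(ε)`-close to `ū` in `C²` — the a-priori information delivered by
every `Hˢ` local existence theorem near the constant state — WITHOUT differentiating the
data-to-solution map: the remainder `r = u - ū - εv` solves the linearised constant-coefficient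
system with zero data and the forcing

  `f = (A₀(ū) - A₀(u))∂ₜu + Σⱼ (Aⱼ(ū) - Aⱼ(u))∂ⱼu - (B(u) - B(ū) - B′(ū)(u - ū)) = Φ(u - ū, ∂ₜu, ∇ₓu)`,

`Φ` smooth with `Φ(0) = 0`, `DΦ(0) = 0` (`remainderMap`), so that `f` and `∇ₓf` are `O(ε²)`
pointwise; on the Fourier side `r̂′ = -G r̂ + A₀⁻¹f̂` (`hasDerivAt_remF`), whence by
Duhamel (`duhamel_mulVec`) and Brenner's bound `‖M_t(ξ)‖ ≤ C₀` on `|t| ≤ T` (both branches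
of Rauch's class) `|2πξⱼ r̂(T, ξ)| ≤ K ∫₀ᵀ |𝓕[∂ⱼf(s)](ξ)| ds`, and Cauchy–Schwarz in `s`,
Fubini and Plancherel give `‖∇ₓr(T)‖²_{L²} ≤ C ε⁴` (`SmallSol.integral_norm_fderiv_sub_sq_le`;
`SmallSol` bundles the standing hypotheses on one solution `u`).

Main results:

* `smallAmplitudeExpansionL2_of_smallSolutions` — for a system in Rauch's class at `ū`,
  `T > 0`, `φ ∈ C_c^∞`: if for all small `ε > 0` there are classical solutions `u_ε` on
  `[0, T]` with data `ū + εφ`, `C²` on the slab, equal to `ū` for `‖x‖ > ρ`, with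
  `‖u_ε - ū‖, ‖Du_ε‖, ‖D²u_ε‖ ≤ Kε` on the open slab, then the conclusion of
  `Rauch1986_smallAmplitudeExpansionL2` holds for `(S, ū, T, φ)`, with `v` the Fourier solution
  of `NoBVEstimatesMultiDLinearizedSolution.lean`;
* `Rauch1986_smallAmplitudeExpansionL2_of_smallSolutions` — hence the named fact follows from
  the pure existence-with-bounds statement (the content of the Local Existence Theorem
  [Rauch1986, p. 482]: [Kato1975], [Majda1984, Ch. 2 Thm 2.1], [Taylor1981, Ch. IV Thm 5.6]).

Everything is proved; no named fact and no `sorry` is introduced.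

## References

* [Rauch1986] J. Rauch, Comm. Math. Phys. 106 (1986) 481–484: Local Existence Theorem and
  Proof of Theorem p. 482, p. 483.
* [Brenner1973] P. Brenner, Ark. Mat. 11 (1973) 75–101: (0.3) p. 75, Lemma 5.1 p. 96.
* [Majda1984] A. Majda, *Compressible Fluid Flow and Systems of Conservation Laws in Several
  Space Variables* (1984), Ch. 2, Thm 2.1–2.2 (existence with uniform `Hˢ` bounds).
-/

noncomputable section

open MeasureTheory Set Filter Matrix FourierTransform Metric Complex intervalIntegral
open scoped ENNReal NNReal ContDiff Topology RealInnerProductSpace Matrix.Norms.Operator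

namespace Literature.Barriers.AtomisticToContinuum

open Literature.Analysis.Fourier Literature.Analysis.FluidPDE Literature.Analysis.Calculus
  Literature.Analysis.FunctionSpaces QuasilinearSystem

variable {d k : ℕ}

/-! ### The nonlinearity of the remainder equation -/

section RemainderMap

variable (d k) in
/-- The data `(u - ū, ∂ₜu, (∂ⱼu)ⱼ)` on which the forcing of the remainder equation depends.
[folklore] -/
abbrev DerivData : Type := (Fin k → ℝ) × (Fin k → ℝ) × (Fin d → Fin k → ℝ)

variable (S : QuasilinearSystem d k) (ubar : Fin k → ℝ)

/-- **The nonlinearity of the remainder equation**: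
`Φ(y₀, y_t, (yⱼ)) = (A₀(ū) - A₀(ū + y₀))y_t + Σⱼ (Aⱼ(ū) - Aⱼ(ū + y₀))yⱼ
  - (B(ū + y₀) - B(ū) - B′(ū)y₀)`. [cite: Rauch1986, Proof of Theorem p. 482] -/
def remainderMap (y : DerivData d k) : Fin k → ℝ :=
  (S.A0 ubar - S.A0 (ubar + y.1)) *ᵥ y.2.1 +
    ∑ j, (S.A j ubar - S.A j (ubar + y.1)) *ᵥ y.2.2 j -
      (S.B (ubar + y.1) - S.B ubar - fderiv ℝ S.B ubar y.1)

/-- `Φ(0) = 0`. [folklore] -/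
@[simp] theorem remainderMap_zero : remainderMap S ubar 0 = 0 := by
  simp [remainderMap]

variable {S ubar}

/-- Smoothness of `x ↦ M(x)w(x)` from entrywise smoothness of `M` and smoothness of `w`.
[folklore] -/
theorem contDiff_mulVec_of_entry {X : Type*} [NormedAddCommGroup X] [NormedSpace ℝ X]
    {n : WithTop ℕ∞} {M : X → Matrix (Fin k) (Fin k) ℝ} {w : X → Fin k → ℝ}
    (hM : ∀ i i', ContDiff ℝ n fun x => M x i i') (hw : ContDiff ℝ n w) :
    ContDiff ℝ n fun x => M x *ᵥ w x := by
  refine contDiff_pi.2 fun i => ?_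
  simp only [Matrix.mulVec, dotProduct]
  exact ContDiff.sum fun i' _ => (hM i i').mul ((contDiff_apply ℝ ℝ i').comp hw)

/-- **`Φ` is smooth.** [folklore] -/
theorem contDiff_remainderMap : ContDiff ℝ ∞ (remainderMap S ubar) := by
  have h1 : ContDiff ℝ ∞ fun y : DerivData d k => ubar + y.1 := contDiff_const.add contDiff_fst
  have hyt : ContDiff ℝ ∞ fun y : DerivData d k => y.2.1 := contDiff_fst.comp contDiff_snd
  have hyx : ∀ j : Fin d, ContDiff ℝ ∞ fun y : DerivData d k => y.2.2 j := fun j =>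
    (contDiff_apply ℝ (Fin k → ℝ) j).comp (contDiff_snd.comp contDiff_snd)
  unfold remainderMap
  refine ((contDiff_mulVec_of_entry (fun i i' => ?_) hyt).add
    (ContDiff.sum fun j _ => contDiff_mulVec_of_entry (fun i i' => ?_) (hyx j))).sub
      (((S.contDiff_B.comp h1).sub contDiff_const).sub
        ((fderiv ℝ S.B ubar).contDiff.comp contDiff_fst))
  · exact contDiff_const.sub ((S.contDiff_A0 i i').comp h1)
  · exact contDiff_const.sub ((S.contDiff_A j i i').comp h1)

/-- Continuity of a matrix-valued map from entrywise continuity (the topology of the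
operator norm on matrices is the product topology). [folklore] -/
theorem continuous_matrix_of_entry {X : Type*} [TopologicalSpace X]
    {M : X → Matrix (Fin k) (Fin k) ℝ} (hM : ∀ i i', Continuous fun x => M x i i') :
    Continuous M :=
  continuous_pi fun i => continuous_pi fun i' => hM i i'

/-- A product `(M(ū) - M(ū + y₀)) w(y)` with `M` continuous and `‖w(y)‖ ≤ ‖y‖` is `o(y)` at `0`,
so it has derivative `0` there. [folklore] -/
theorem hasFDerivAt_sub_mulVec_zero {M : (Fin k → ℝ) → Matrix (Fin k) (Fin k) ℝ}
    (hM : ∀ i i', Continuous fun u => M u i i') {w : DerivData d k → Fin k → ℝ}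
    (hw : ∀ y, ‖w y‖ ≤ ‖y‖) :
    HasFDerivAt (fun y : DerivData d k => (M ubar - M (ubar + y.1)) *ᵥ w y)
      (0 : DerivData d k →L[ℝ] (Fin k → ℝ)) 0 := by
  have hw0 : w 0 = 0 := by
    have h := hw 0
    rw [norm_zero] at h
    exact norm_le_zero_iff.1 h
  rw [hasFDerivAt_iff_isLittleO_nhds_zero]
  simp only [zero_add, Prod.fst_zero, add_zero, sub_self, Matrix.zero_mulVec, sub_zero,
    _root_.zero_apply]
  refine Asymptotics.isLittleO_iff.2 fun c hc => ?_
  have hcont : Continuous fun y : DerivData d k => M ubar - M (ubar + y.1) :=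
    continuous_const.sub ((continuous_matrix_of_entry hM).comp (continuous_const.add continuous_fst))
  have hev : ∀ᶠ y : DerivData d k in 𝓝 0, ‖M ubar - M (ubar + y.1)‖ < c := by
    have h := (hcont.tendsto 0)
    simp only [Prod.fst_zero, add_zero, sub_self] at h
    exact (NormedAddGroup.tendsto_nhds_zero.1 h) c hc
  filter_upwards [hev] with y hy
  calc ‖(M ubar - M (ubar + y.1)) *ᵥ w y‖ ≤ ‖M ubar - M (ubar + y.1)‖ * ‖w y‖ :=
        Matrix.linfty_opNorm_mulVec _ _
    _ ≤ c * ‖y‖ := mul_le_mul hy.le (hw y) (norm_nonneg _) hc.le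

/-- **`DΦ(0) = 0`**: every term of `Φ` is a product of two factors vanishing at `0`, or the
second-order Taylor remainder of `B` at `ū`. [folklore] -/
theorem hasFDerivAt_remainderMap_zero :
    HasFDerivAt (remainderMap S ubar) (0 : DerivData d k →L[ℝ] (Fin k → ℝ)) 0 := by
  -- the two transport terms
  have hT1 : HasFDerivAt (fun y : DerivData d k => (S.A0 ubar - S.A0 (ubar + y.1)) *ᵥ y.2.1)
      (0 : DerivData d k →L[ℝ] (Fin k → ℝ)) 0 :=
    hasFDerivAt_sub_mulVec_zero (fun i i' => (S.contDiff_A0 i i').continuous)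
      (fun y => (norm_fst_le y.2).trans (norm_snd_le y))
  have hT2 : ∀ j : Fin d, HasFDerivAt
      (fun y : DerivData d k => (S.A j ubar - S.A j (ubar + y.1)) *ᵥ y.2.2 j)
      (0 : DerivData d k →L[ℝ] (Fin k → ℝ)) 0 := fun j =>
    hasFDerivAt_sub_mulVec_zero (fun i i' => (S.contDiff_A j i i').continuous)
      (fun y => ((norm_le_pi_norm y.2.2 j).trans (norm_snd_le y.2)).trans (norm_snd_le y))
  have hT2s : HasFDerivAt
      (fun y : DerivData d k => ∑ j, (S.A j ubar - S.A j (ubar + y.1)) *ᵥ y.2.2 j)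
      (0 : DerivData d k →L[ℝ] (Fin k → ℝ)) 0 := by
    have h := HasFDerivAt.fun_sum (u := Finset.univ) fun j _ => hT2 j
    simpa using h
  -- the second-order Taylor remainder of `B` at `ū`
  have hB : HasFDerivAt
      (fun y : DerivData d k => S.B (ubar + y.1) - S.B ubar - fderiv ℝ S.B ubar y.1)
      (0 : DerivData d k →L[ℝ] (Fin k → ℝ)) 0 := by
    have h1 : HasFDerivAt (fun y : DerivData d k => ubar + y.1)
        (ContinuousLinearMap.fst ℝ (Fin k → ℝ) ((Fin k → ℝ) × (Fin d → Fin k → ℝ))) 0 :=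
      hasFDerivAt_fst.const_add ubar
    have hBd : HasFDerivAt S.B (fderiv ℝ S.B ubar) ubar :=
      ((S.contDiff_B.differentiable (by simp)).differentiableAt).hasFDerivAt
    have hBd' : HasFDerivAt S.B (fderiv ℝ S.B ubar) ((fun y : DerivData d k => ubar + y.1) 0) := by
      simpa using hBd
    have hcomp := hBd'.comp (0 : DerivData d k) h1
    have hlin : HasFDerivAt (fun y : DerivData d k => fderiv ℝ S.B ubar y.1)
        ((fderiv ℝ S.B ubar).comp
          (ContinuousLinearMap.fst ℝ (Fin k → ℝ) ((Fin k → ℝ) × (Fin d → Fin k → ℝ)))) 0 :=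
      ((fderiv ℝ S.B ubar).comp (ContinuousLinearMap.fst ℝ (Fin k → ℝ)
        ((Fin k → ℝ) × (Fin d → Fin k → ℝ)))).hasFDerivAt
    have h := (hcomp.sub_const (S.B ubar)).sub hlin
    rw [sub_self] at h
    exact h
  have h := (hT1.add hT2s).sub hB
  rw [add_zero, sub_zero] at h
  exact h

end RemainderMap

/-! ### The data field `(u - ū, ∂ₜu, ∇ₓu)` of a classical solution and the forcing -/

section Forcing

variable {S : QuasilinearSystem d k} {ubar : Fin k → ℝ} {u : ℝ → Space d → Fin k → ℝ}
  {T ρ K ε : ℝ}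

variable (u ubar) in
/-- The data field `U(t, x) = (u - ū, ∂ₜu, (∂ⱼu)ⱼ)(t, x)` of a space-time field `u`, the
derivatives being those of `uncurry u` at `(t, x)`. [folklore] -/
def derivData (p : ℝ × Space d) : DerivData d k :=
  (u p.1 p.2 - ubar, fderiv ℝ (Function.uncurry u) p (1, 0),
    fun j => fderiv ℝ (Function.uncurry u) p (0, EuclideanSpace.single j 1))

variable (S ubar u) in
/-- **The forcing of the remainder equation**, `f(t, x) = Φ(U(t, x))`.
[cite: Rauch1986, Proof of Theorem p. 482] -/
def forcing (p : ℝ × Space d) : Fin k → ℝ :=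
  remainderMap S ubar (derivData ubar u p)

/-- The open slab `(0, T) × ℝᵈ` is open. [folklore] -/
theorem isOpen_openSlab (T : ℝ) : IsOpen (Ioo 0 T ×ˢ (univ : Set (Space d))) :=
  isOpen_Ioo.prod isOpen_univ

/-- On the open slab a field that is `C²` on the closed slab is `C²` near every point. [folklore] -/
theorem contDiffAt_of_slab (h2 : ContDiffOn ℝ 2 (Function.uncurry u) (Icc 0 T ×ˢ univ))
    {p : ℝ × Space d} (hp : p.1 ∈ Ioo 0 T) : ContDiffAt ℝ 2 (Function.uncurry u) p :=
  (h2.mono (prod_mono Ioo_subset_Icc_self subset_rfl)).contDiffAt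
    ((isOpen_openSlab T).mem_nhds ⟨hp, mem_univ _⟩)

/-- **The data field is `C¹` on the open slab** when `u` is `C²` on the closed slab. [folklore] -/
theorem contDiffOn_derivData (h2 : ContDiffOn ℝ 2 (Function.uncurry u) (Icc 0 T ×ˢ univ)) :
    ContDiffOn ℝ 1 (derivData ubar u) (Ioo 0 T ×ˢ univ) := by
  have hO := isOpen_openSlab (d := d) T
  have h2' : ContDiffOn ℝ 2 (Function.uncurry u) (Ioo 0 T ×ˢ univ) :=
    h2.mono (prod_mono Ioo_subset_Icc_self subset_rfl)
  have hD : ContDiffOn ℝ 1 (fun p => fderiv ℝ (Function.uncurry u) p) (Ioo 0 T ×ˢ univ) :=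
    h2'.fderiv_of_isOpen hO (by norm_num)
  refine ((h2'.of_le (by norm_num)).sub contDiffOn_const).prodMk
    ((hD.clm_apply contDiffOn_const).prodMk (contDiffOn_pi.2 fun j => hD.clm_apply contDiffOn_const))

/-- **The forcing is `C¹` on the open slab.** [folklore] -/
theorem contDiffOn_forcing (h2 : ContDiffOn ℝ 2 (Function.uncurry u) (Icc 0 T ×ˢ univ)) :
    ContDiffOn ℝ 1 (forcing S ubar u) (Ioo 0 T ×ˢ univ) :=
  (contDiff_remainderMap.of_le (by exact_mod_cast le_top)).comp_contDiffOn (contDiffOn_derivData h2)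

/-- **Support**: where `u = ū` on the open exterior region, the data field vanishes.
[folklore] -/
theorem derivData_eq_zero (hsupp : ∀ t ∈ Icc 0 T, ∀ x : Space d, ρ < ‖x‖ → u t x = ubar)
    {p : ℝ × Space d} (hp : p.1 ∈ Ioo 0 T) (hx : ρ < ‖p.2‖) : derivData ubar u p = 0 := by
  have ho : IsOpen (Ioo 0 T ×ˢ {y : Space d | ρ < ‖y‖}) :=
    isOpen_Ioo.prod (isOpen_lt continuous_const continuous_norm)
  have heq : Function.uncurry u =ᶠ[𝓝 p] fun _ => ubar :=
    Filter.eventuallyEq_of_mem (ho.mem_nhds ⟨hp, hx⟩)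
      fun q hq => hsupp q.1 (Ioo_subset_Icc_self hq.1) q.2 hq.2
  have hfd : fderiv ℝ (Function.uncurry u) p = 0 := by
    rw [heq.fderiv_eq, fderiv_const_apply]
  have hu : u p.1 p.2 = ubar := hsupp p.1 (Ioo_subset_Icc_self hp) p.2 hx
  simp only [derivData, hfd, hu, sub_self, _root_.zero_apply]
  rfl

/-- Hence the forcing vanishes there. [folklore] -/
theorem forcing_eq_zero (hsupp : ∀ t ∈ Icc 0 T, ∀ x : Space d, ρ < ‖x‖ → u t x = ubar)
    {p : ℝ × Space d} (hp : p.1 ∈ Ioo 0 T) (hx : ρ < ‖p.2‖) : forcing S ubar u p = 0 := by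
  rw [forcing, derivData_eq_zero hsupp hp hx, remainderMap_zero]

/-- `‖(1, 0)‖ = 1` in `ℝ × ℝᵈ`. [folklore] -/
theorem norm_one_zero : ‖((1 : ℝ), (0 : Space d))‖ = 1 := by
  simp [Prod.norm_def]

/-- `‖(0, eⱼ)‖ = 1` in `ℝ × ℝᵈ`. [folklore] -/
theorem norm_zero_single (j : Fin d) : ‖((0 : ℝ), EuclideanSpace.single j (1 : ℝ))‖ = 1 := by
  rw [Prod.norm_def, norm_zero, PiLp.norm_single, norm_one, max_eq_right zero_le_one]

/-- **Size of the data field**: `‖U(t, x)‖ ≤ Kε` from `‖u - ū‖, ‖Du‖ ≤ Kε` (interior times).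
[folklore] -/
theorem norm_derivData_le (hKε : 0 ≤ K * ε)
    (hb0 : ∀ p : ℝ × Space d, p.1 ∈ Ioo 0 T → ‖u p.1 p.2 - ubar‖ ≤ K * ε)
    (hb1 : ∀ p : ℝ × Space d, p.1 ∈ Ioo 0 T → ‖fderiv ℝ (Function.uncurry u) p‖ ≤ K * ε)
    {p : ℝ × Space d} (hp : p.1 ∈ Ioo 0 T) : ‖derivData ubar u p‖ ≤ K * ε := by
  simp only [derivData, Prod.norm_def]
  refine max_le (hb0 p hp) (max_le ?_ ?_)
  · calc ‖fderiv ℝ (Function.uncurry u) p (1, 0)‖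
        ≤ ‖fderiv ℝ (Function.uncurry u) p‖ * ‖((1 : ℝ), (0 : Space d))‖ :=
          ContinuousLinearMap.le_opNorm _ _
      _ ≤ K * ε := by rw [norm_one_zero, mul_one]; exact hb1 p hp
  · refine (pi_norm_le_iff_of_nonneg hKε).2 fun j => ?_
    calc ‖fderiv ℝ (Function.uncurry u) p (0, EuclideanSpace.single j 1)‖
        ≤ ‖fderiv ℝ (Function.uncurry u) p‖ * ‖((0 : ℝ), EuclideanSpace.single j (1 : ℝ))‖ :=
          ContinuousLinearMap.le_opNorm _ _
      _ ≤ K * ε := by rw [norm_zero_single, mul_one]; exact hb1 p hp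

/-- **The derivative of the data field** at an interior point: with `D₁ = D(uncurry u)(p)` and
`D₂ = D²(uncurry u)(p)`, `DU(p) w = (D₁w, D₂w(1,0), (D₂w(0,eⱼ))ⱼ)`. [folklore] -/
theorem hasFDerivAt_derivData (h2 : ContDiffOn ℝ 2 (Function.uncurry u) (Icc 0 T ×ˢ univ))
    {p : ℝ × Space d} (hp : p.1 ∈ Ioo 0 T) :
    HasFDerivAt (derivData ubar u)
      ((fderiv ℝ (Function.uncurry u) p).prod
        (((fderiv ℝ (fun q => fderiv ℝ (Function.uncurry u) q) p).flip (1, 0)).prod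
          (ContinuousLinearMap.pi fun j =>
            (fderiv ℝ (fun q => fderiv ℝ (Function.uncurry u) q) p).flip
              (0, EuclideanSpace.single j 1)))) p := by
  have hc2 := contDiffAt_of_slab h2 hp
  have hd1 : HasFDerivAt (Function.uncurry u) (fderiv ℝ (Function.uncurry u) p) p :=
    (hc2.differentiableAt (by norm_num)).hasFDerivAt
  have hd2 : HasFDerivAt (fun q => fderiv ℝ (Function.uncurry u) q)
      (fderiv ℝ (fun q => fderiv ℝ (Function.uncurry u) q) p) p :=
    ((hc2.fderiv_right (m := 1) (by norm_num)).differentiableAt one_ne_zero).hasFDerivAt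
  have happ : ∀ w : ℝ × Space d, HasFDerivAt (fun q => fderiv ℝ (Function.uncurry u) q w)
      ((fderiv ℝ (fun q => fderiv ℝ (Function.uncurry u) q) p).flip w) p := by
    intro w
    have h := hd2.clm_apply (hasFDerivAt_const w p)
    simpa using h
  refine (hd1.sub_const ubar).prodMk ((happ (1, 0)).prodMk ?_)
  exact hasFDerivAt_pi.2 fun j => happ (0, EuclideanSpace.single j 1)

/-- **Size of the derivative of the data field**: `‖DU(p)‖ ≤ Kε` from `‖Du‖, ‖D²u‖ ≤ Kε`.
[folklore] -/
theorem norm_fderiv_derivData_le (h2 : ContDiffOn ℝ 2 (Function.uncurry u) (Icc 0 T ×ˢ univ))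
    (hKε : 0 ≤ K * ε)
    (hb1 : ∀ p : ℝ × Space d, p.1 ∈ Ioo 0 T → ‖fderiv ℝ (Function.uncurry u) p‖ ≤ K * ε)
    (hb2 : ∀ p : ℝ × Space d, p.1 ∈ Ioo 0 T →
      ‖fderiv ℝ (fun q => fderiv ℝ (Function.uncurry u) q) p‖ ≤ K * ε)
    {p : ℝ × Space d} (hp : p.1 ∈ Ioo 0 T) : ‖fderiv ℝ (derivData ubar u) p‖ ≤ K * ε := by
  rw [(hasFDerivAt_derivData h2 hp).fderiv]
  set D₁ := fderiv ℝ (Function.uncurry u) p with hD₁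
  set D₂ := fderiv ℝ (fun q => fderiv ℝ (Function.uncurry u) q) p with hD₂
  refine ContinuousLinearMap.opNorm_le_bound _ hKε fun w => ?_
  have h1 : ‖D₁ w‖ ≤ K * ε * ‖w‖ := (D₁.le_opNorm w).trans
    (mul_le_mul_of_nonneg_right (hb1 p hp) (norm_nonneg _))
  have h2w : ∀ v : ℝ × Space d, ‖v‖ = 1 → ‖D₂ w v‖ ≤ K * ε * ‖w‖ := by
    intro v hv
    calc ‖D₂ w v‖ ≤ ‖D₂ w‖ * ‖v‖ := (D₂ w).le_opNorm v
      _ = ‖D₂ w‖ := by rw [hv, mul_one]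
      _ ≤ ‖D₂‖ * ‖w‖ := D₂.le_opNorm w
      _ ≤ K * ε * ‖w‖ := mul_le_mul_of_nonneg_right (hb2 p hp) (norm_nonneg _)
  simp only [ContinuousLinearMap.prod_apply, Prod.norm_def, ContinuousLinearMap.flip_apply]
  refine max_le h1 (max_le (h2w _ norm_one_zero) ?_)
  exact (pi_norm_le_iff_of_nonneg (by positivity)).2 fun j => h2w _ (norm_zero_single j)

/-- **The forcing and its derivative are `O(ε²)`**: if `Φ` obeys the quadratic bounds with
constant `C` on the ball of radius `r` and `Kε ≤ r`, then at interior points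
`‖f(p)‖ ≤ C(Kε)²` and `‖Df(p)‖ ≤ C(Kε)²`. [cite: Rauch1986, Proof of Theorem p. 482] -/
theorem norm_forcing_le (h2 : ContDiffOn ℝ 2 (Function.uncurry u) (Icc 0 T ×ˢ univ))
    (hKε : 0 ≤ K * ε) {C r : ℝ} (hC : 0 ≤ C)
    (hΦ : ∀ y : DerivData d k, ‖y‖ ≤ r →
      ‖fderiv ℝ (remainderMap S ubar) y‖ ≤ C * ‖y‖ ∧ ‖remainderMap S ubar y‖ ≤ C * ‖y‖ ^ 2)
    (hr : K * ε ≤ r)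
    (hb0 : ∀ p : ℝ × Space d, p.1 ∈ Ioo 0 T → ‖u p.1 p.2 - ubar‖ ≤ K * ε)
    (hb1 : ∀ p : ℝ × Space d, p.1 ∈ Ioo 0 T → ‖fderiv ℝ (Function.uncurry u) p‖ ≤ K * ε)
    (hb2 : ∀ p : ℝ × Space d, p.1 ∈ Ioo 0 T →
      ‖fderiv ℝ (fun q => fderiv ℝ (Function.uncurry u) q) p‖ ≤ K * ε)
    {p : ℝ × Space d} (hp : p.1 ∈ Ioo 0 T) :
    ‖forcing S ubar u p‖ ≤ C * (K * ε) ^ 2 ∧ ‖fderiv ℝ (forcing S ubar u) p‖ ≤ C * (K * ε) ^ 2 := by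
  have hU : ‖derivData ubar u p‖ ≤ K * ε := norm_derivData_le hKε hb0 hb1 hp
  have hUr : ‖derivData ubar u p‖ ≤ r := hU.trans hr
  obtain ⟨hD, hV⟩ := hΦ _ hUr
  refine ⟨hV.trans (mul_le_mul_of_nonneg_left (pow_le_pow_left₀ (norm_nonneg _) hU 2) hC), ?_⟩
  -- chain rule
  have hdU : DifferentiableAt ℝ (derivData ubar u) p := (hasFDerivAt_derivData h2 hp).differentiableAt
  have hdΦ : DifferentiableAt ℝ (remainderMap S ubar) (derivData ubar u p) :=
    (contDiff_remainderMap.differentiable (by simp)).differentiableAt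
  have hcomp : fderiv ℝ (forcing S ubar u) p =
      (fderiv ℝ (remainderMap S ubar) (derivData ubar u p)).comp (fderiv ℝ (derivData ubar u) p) := by
    rw [show forcing S ubar u = remainderMap S ubar ∘ derivData ubar u from rfl, fderiv_comp p hdΦ hdU]
  rw [hcomp]
  calc ‖(fderiv ℝ (remainderMap S ubar) (derivData ubar u p)).comp (fderiv ℝ (derivData ubar u) p)‖
      ≤ ‖fderiv ℝ (remainderMap S ubar) (derivData ubar u p)‖ * ‖fderiv ℝ (derivData ubar u) p‖ :=
        ContinuousLinearMap.opNorm_comp_le _ _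
    _ ≤ (C * (K * ε)) * (K * ε) :=
        mul_le_mul (hD.trans (mul_le_mul_of_nonneg_left hU hC))
          (norm_fderiv_derivData_le h2 hKε hb1 hb2 hp) (norm_nonneg _) (by positivity)
    _ = C * (K * ε) ^ 2 := by ring

end Forcing

/-! ### The remainder equation and its Fourier transform -/

section FourierODE

variable {S : QuasilinearSystem d k} {ubar : Fin k → ℝ} {u : ℝ → Space d → Fin k → ℝ}
  {T ρ : ℝ}

/-- `𝓕(c f) = c 𝓕f` for a complex constant. [folklore] -/
theorem fourier_const_smul_apply (c : ℂ) (f : Space d → Fin k → ℂ) (ξ : Space d) :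
    𝓕 (fun x => c • f x) ξ = c • 𝓕 f ξ := by
  rw [Real.fourier_eq, Real.fourier_eq, ← MeasureTheory.integral_smul]
  refine integral_congr_ae (Eventually.of_forall fun v => ?_)
  simp only [Circle.smul_def, smul_smul, mul_comm]

/-- **The remainder equation** (interior times): the constant-coefficient operator at `ū`
applied to `(u - ū, ∂ₜu)` IS the forcing, by the equation (1) for `u` and `B(ū) = 0`:
`A₀(ū)∂ₜu + Σ Aⱼ(ū)∂ⱼu + B′(ū)(u - ū) = f`. [cite: Rauch1986, Proof of Theorem p. 482] -/
theorem constCoeffOp_eq_forcing (hS : S.IsRauchClass ubar) (hu : S.IsClassicalSolution T u)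
    {t : ℝ} (ht : t ∈ Ioo 0 T) (x : Space d) :
    constCoeffOp (S.A0 ubar) (fun j => S.A j ubar) (fderiv ℝ S.B ubar) (fun y => u t y - ubar)
      (fun y => fderiv ℝ (Function.uncurry u) (t, y) (1, 0)) x = forcing S ubar u (t, x) := by
  have heq := hu.eqn_fderiv ht x
  have hsl : ∀ j, fderiv ℝ (fun y => u t y - ubar) x (EuclideanSpace.single j 1) =
      fderiv ℝ (Function.uncurry u) (t, x) (0, EuclideanSpace.single j 1) := by
    intro j
    rw [fderiv_sub_const, hu.fderiv_slice_eq_fderiv ht x]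
  simp only [constCoeffOp, forcing, remainderMap, derivData, hsl, add_sub_cancel, hS.B_eq_zero,
    sub_zero, sub_mulVec, Finset.sum_sub_distrib]
  have heq' : S.A0 (u t x) *ᵥ fderiv ℝ (Function.uncurry u) (t, x) (1, 0) +
      ∑ j, S.A j (u t x) *ᵥ fderiv ℝ (Function.uncurry u) (t, x) (0, EuclideanSpace.single j 1) +
        S.B (u t x) = 0 := by
    rw [heq, neg_add_cancel]
  linear_combination heq'

variable (u ubar) in
/-- The complexified deviation slices `(u(t) - ū)_ℂ`. [folklore] -/
def devC (t : ℝ) : Space d → Fin k → ℂ := cplx fun x => u t x - ubar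

/-- The deviation slices are `C¹` on the closed slab. [folklore] -/
theorem contDiffOn_uncurry_devC (hu : S.IsClassicalSolution T u) :
    ContDiffOn ℝ 1 (Function.uncurry (devC ubar u)) (Icc 0 T ×ˢ univ) := by
  have h : Function.uncurry (devC ubar u) = ofRealPi ∘ fun p => Function.uncurry u p - ubar := by
    funext p; rfl
  rw [h]
  exact ofRealPi.contDiff.comp_contDiffOn (hu.contDiffOn.sub contDiffOn_const)

/-- The deviation slices vanish for `‖x‖ > ρ`. [folklore] -/
theorem devC_eq_zero (hsupp : ∀ t ∈ Icc 0 T, ∀ x : Space d, ρ < ‖x‖ → u t x = ubar) :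
    ∀ t ∈ Icc 0 T, ∀ x : Space d, ρ < ‖x‖ → devC ubar u t x = 0 := by
  intro t ht x hx
  rw [devC, cplx_apply, hsupp t ht x hx, sub_self, map_zero]

/-- The time derivative of the deviation slices is `(∂ₜu)_ℂ`. [folklore] -/
theorem timeDeriv_devC (hu : S.IsClassicalSolution T u) {t : ℝ} (ht : t ∈ Ioo 0 T) (x : Space d) :
    Literature.Analysis.Fourier.timeDeriv (devC ubar u) t x =
      ofRealPi (fderiv ℝ (Function.uncurry u) (t, x) (1, 0)) := by
  have h : Function.uncurry (devC ubar u) = ofRealPi ∘ fun p => Function.uncurry u p - ubar := by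
    funext p; rfl
  have hd : DifferentiableAt ℝ (fun p => Function.uncurry u p - ubar) (t, x) :=
    (hu.differentiableAt_uncurry (p := (t, x)) ht).sub_const ubar
  rw [Literature.Analysis.Fourier.timeDeriv_apply, h,
    (ofRealPi.hasFDerivAt.comp (t, x) hd.hasFDerivAt).fderiv, fderiv_sub_const]
  rfl

/-- The time-derivative slice `x ↦ ∂ₜu(t, x)` is continuous at interior times. [folklore] -/
theorem continuous_timeSlot (h2 : ContDiffOn ℝ 2 (Function.uncurry u) (Icc 0 T ×ˢ univ))
    {t : ℝ} (ht : t ∈ Ioo 0 T) :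
    Continuous fun y : Space d => fderiv ℝ (Function.uncurry u) (t, y) (1, 0) := by
  have hO := isOpen_openSlab (d := d) T
  have hcD : ContinuousOn (fderiv ℝ (Function.uncurry u)) (Ioo 0 T ×ˢ univ) :=
    (h2.mono (prod_mono Ioo_subset_Icc_self subset_rfl)).continuousOn_fderiv_of_isOpen hO
      (by norm_num)
  have h1 : Continuous fun y : Space d => fderiv ℝ (Function.uncurry u) (t, y) :=
    (hcD.comp_continuous (continuous_const.prodMk continuous_id) fun y => ⟨ht, mem_univ y⟩ :)
  exact (ContinuousLinearMap.apply ℝ (Fin k → ℝ) ((1 : ℝ), (0 : Space d))).continuous.comp h1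

/-- The time-derivative slice vanishes for `‖x‖ > ρ` at interior times. [folklore] -/
theorem timeSlot_eq_zero (hsupp : ∀ t ∈ Icc 0 T, ∀ x : Space d, ρ < ‖x‖ → u t x = ubar)
    {t : ℝ} (ht : t ∈ Ioo 0 T) {x : Space d} (hx : ρ < ‖x‖) :
    fderiv ℝ (Function.uncurry u) (t, x) (1, 0) = 0 := by
  have h := derivData_eq_zero (ubar := ubar) hsupp (p := (t, x)) ht hx
  simp only [derivData, Prod.mk_eq_zero] at h
  exact h.2.1

/-- **The time-derivative slot on the Fourier side** (interior times):
`𝓕[(∂ₜu)_ℂ](ξ) = -G(ξ) 𝓕[(u - ū)_ℂ](ξ) + A₀⁻¹_ℂ 𝓕[f_ℂ](ξ)`.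
[cite: Rauch1986, Proof of Theorem p. 483; Brenner1973, Lemma 5.1 p. 96] -/
theorem fourier_timeSlot_eq (hS : S.IsRauchClass ubar) (hu : S.IsClassicalSolution T u)
    (h2 : ContDiffOn ℝ 2 (Function.uncurry u) (Icc 0 T ×ˢ univ))
    (hsupp : ∀ t ∈ Icc 0 T, ∀ x : Space d, ρ < ‖x‖ → u t x = ubar) {t : ℝ} (ht : t ∈ Ioo 0 T)
    (ξ : Space d) :
    𝓕 (cplx fun y => fderiv ℝ (Function.uncurry u) (t, y) (1, 0)) ξ =
      -(rauchGenerator (S.A0 ubar) (fun j => S.A j ubar) (fderiv ℝ S.B ubar) ξ *ᵥ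
          𝓕 (devC ubar u t) ξ) +
        ((S.A0 ubar)⁻¹).map (algebraMap ℝ ℂ) *ᵥ 𝓕 (cplx fun y => forcing S ubar u (t, y)) ξ := by
  have hdet : (S.A0 ubar).det ≠ 0 := det_ne_zero_of_isRauchClass hS.linearization
  have htI : t ∈ Icc 0 T := Ioo_subset_Icc_self ht
  have hg : ContDiff ℝ 1 fun y => u t y - ubar := (hu.contDiff_slice htI).sub contDiff_const
  have hgc : HasCompactSupport fun y => u t y - ubar := by
    simpa using hasCompactSupport_sub_const_of_norm_gt (fun y hy => hsupp t htI y hy)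
  have hh : Continuous fun y : Space d => fderiv ℝ (Function.uncurry u) (t, y) (1, 0) :=
    continuous_timeSlot h2 ht
  have hhc : HasCompactSupport fun y : Space d => fderiv ℝ (Function.uncurry u) (t, y) (1, 0) := by
    refine HasCompactSupport.intro (isCompact_closedBall (0 : Space d) ρ) fun y hy => ?_
    rw [mem_closedBall_zero_iff, not_le] at hy
    exact timeSlot_eq_zero hsupp ht hy
  have h := fourier_cplx_eq_of_constCoeffOp (A := fun j => S.A j ubar) (B₁ := fderiv ℝ S.B ubar)
    hdet hg hgc hh hhc ξ
  have hf : constCoeffOp (S.A0 ubar) (fun j => S.A j ubar) (fderiv ℝ S.B ubar) (fun y => u t y - ubar)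
      (fun y => fderiv ℝ (Function.uncurry u) (t, y) (1, 0)) = fun y => forcing S ubar u (t, y) :=
    funext fun y => constCoeffOp_eq_forcing hS hu ht y
  rw [hf] at h
  exact h

/-- **Time derivative of `𝓕[(u - ū)_ℂ]`** at interior times (differentiation under the
integral, `hasDerivAt_fourier_slice`): it is `𝓕[(∂ₜu)_ℂ]`. [folklore] -/
theorem hasDerivAt_fourier_devC (hu : S.IsClassicalSolution T u)
    (hsupp : ∀ t ∈ Icc 0 T, ∀ x : Space d, ρ < ‖x‖ → u t x = ubar) {t : ℝ} (ht : t ∈ Ioo 0 T)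
    (ξ : Space d) :
    HasDerivAt (fun s => 𝓕 (devC ubar u s) ξ)
      (𝓕 (cplx fun y => fderiv ℝ (Function.uncurry u) (t, y) (1, 0)) ξ) t := by
  have h := hasDerivAt_fourier_slice (contDiffOn_uncurry_devC hu) (devC_eq_zero hsupp) ht ξ
  have heq : Literature.Analysis.Fourier.timeDeriv (devC ubar u) t =
      cplx fun y => fderiv ℝ (Function.uncurry u) (t, y) (1, 0) := by
    funext y
    rw [timeDeriv_devC hu ht y, cplx_apply]
  rwa [heq] at h

variable (S ubar u) in
/-- **The Fourier transform of the remainder slices**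
`Ŵ(t, ξ) = 𝓕[(u(t) - ū)_ℂ](ξ) - ε M_t(ξ) 𝓕φ_ℂ(ξ)` (`= 𝓕[(u - ū - εv)(t)_ℂ]` for the Fourier
solution `v`, `fourier_cplx_fourierSolution`). [cite: Rauch1986, Proof of Theorem p. 482] -/
def remF (φ : Space d → Fin k → ℝ) (ε t : ℝ) (ξ : Space d) : Fin k → ℂ :=
  𝓕 (devC ubar u t) ξ -
    (ε : ℂ) • (rauchSymbol (S.A0 ubar) (fun j => S.A j ubar) (fderiv ℝ S.B ubar) t ξ *ᵥ 𝓕 (cplx φ) ξ)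

/-- **The Fourier-side remainder equation** `Ŵ′ = -GŴ + A₀⁻¹f̂` at interior times.
[cite: Rauch1986, Proof of Theorem p. 482; Brenner1973, Lemma 5.1 p. 96] -/
theorem hasDerivAt_remF (hS : S.IsRauchClass ubar) (hu : S.IsClassicalSolution T u)
    (h2 : ContDiffOn ℝ 2 (Function.uncurry u) (Icc 0 T ×ˢ univ))
    (hsupp : ∀ t ∈ Icc 0 T, ∀ x : Space d, ρ < ‖x‖ → u t x = ubar) (φ : Space d → Fin k → ℝ)
    (ε : ℝ) {t : ℝ} (ht : t ∈ Ioo 0 T) (ξ : Space d) :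
    HasDerivAt (fun s => remF S ubar u φ ε s ξ)
      (-(rauchGenerator (S.A0 ubar) (fun j => S.A j ubar) (fderiv ℝ S.B ubar) ξ *ᵥ
          remF S ubar u φ ε t ξ) +
        ((S.A0 ubar)⁻¹).map (algebraMap ℝ ℂ) *ᵥ 𝓕 (cplx fun y => forcing S ubar u (t, y)) ξ) t := by
  set G := rauchGenerator (S.A0 ubar) (fun j => S.A j ubar) (fderiv ℝ S.B ubar) ξ with hG
  have h1 := hasDerivAt_fourier_devC hu hsupp ht ξ
  rw [fourier_timeSlot_eq hS hu h2 hsupp ht ξ] at h1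
  have h2' := (hasDerivAt_mulVec (hasDerivAt_rauchSymbol (A₀ := S.A0 ubar)
    (A := fun j => S.A j ubar) (B₁ := fderiv ℝ S.B ubar) t ξ)
    (hasDerivAt_const t (𝓕 (cplx φ) ξ))).const_smul (ε : ℂ)
  have h := h1.sub h2'
  refine h.congr_deriv ?_
  simp only [remF, mulVec_zero, zero_add, Matrix.neg_mul, Matrix.neg_mulVec, smul_neg,
    sub_neg_eq_add, mulVec_sub, mulVec_smul, mulVec_mulVec]
  abel

/-- **`Ŵ` is continuous on `[0, T]`.** [folklore] -/
theorem continuousOn_remF (hu : S.IsClassicalSolution T u)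
    (hsupp : ∀ t ∈ Icc 0 T, ∀ x : Space d, ρ < ‖x‖ → u t x = ubar) (φ : Space d → Fin k → ℝ)
    (ε : ℝ) (ξ : Space d) : ContinuousOn (fun s => remF S ubar u φ ε s ξ) (Icc 0 T) := by
  refine (continuousOn_fourier_slice (contDiffOn_uncurry_devC hu).continuousOn
    (devC_eq_zero hsupp) ξ).sub (Continuous.continuousOn ?_)
  refine (continuous_const (y := (ε : ℂ))).smul ?_
  have hM : Continuous fun s : ℝ =>
      rauchSymbol (S.A0 ubar) (fun j => S.A j ubar) (fderiv ℝ S.B ubar) s ξ :=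
    continuous_rauchSymbol_comp continuous_id continuous_const
  exact hM.matrix_mulVec continuous_const

/-- **`Ŵ(0) = 0`** for data `u(0) = ū + εφ`. [folklore] -/
theorem remF_zero {φ : Space d → Fin k → ℝ} {ε : ℝ} (h0 : ∀ x, u 0 x = ubar + ε • φ x)
    (ξ : Space d) :
    remF S ubar u φ ε 0 ξ = 0 := by
  have hdev : devC ubar u 0 = fun x => (ε : ℂ) • cplx φ x := by
    funext x
    rw [devC, cplx_apply, h0 x, add_sub_cancel_left, map_smul, cplx_apply, Complex.coe_smul]
  rw [remF, hdev, fourier_const_smul_apply, rauchSymbol_zero, Pi.one_apply, one_mulVec, sub_self]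

end FourierODE

/-! ### Parametric Fourier integrals: continuity, bounds, interval integrability -/

section Param

/-- **Joint continuity of parametric Fourier integrals**: if `(t, x) ↦ f(t, x)` is continuous on
`I × ℝᵈ`, vanishes for `‖x‖ > ρ'` and is bounded by `C` there, then `(t, ξ) ↦ 𝓕[f(t)](ξ)` is
continuous on `I × ℝᵈ` (dominated convergence). [folklore] -/
theorem continuousOn_fourier_param {I : Set ℝ} {f : ℝ → Space d → Fin k → ℂ} {ρ' C : ℝ}
    (hcont : ContinuousOn (Function.uncurry f) (I ×ˢ univ))
    (hsupp : ∀ t ∈ I, ∀ x : Space d, ρ' < ‖x‖ → f t x = 0) (hbd : ∀ t ∈ I, ∀ x, ‖f t x‖ ≤ C) :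
    ContinuousOn (fun q : ℝ × Space d => 𝓕 (f q.1) q.2) (I ×ˢ univ) := by
  simp_rw [Real.fourier_eq]
  refine continuousOn_of_dominated (bound := (closedBall (0 : Space d) ρ').indicator fun _ => C)
    ?_ ?_ ?_ ?_
  · rintro q ⟨hq, -⟩
    have hsl : Continuous fun x => f q.1 x :=
      (hcont.comp_continuous (continuous_const.prodMk continuous_id) fun x => ⟨hq, mem_univ x⟩ :)
    exact ((continuous_fourierKernel q.2).smul hsl).aestronglyMeasurable
  · rintro q ⟨hq, -⟩
    refine Eventually.of_forall fun x => ?_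
    rw [Circle.norm_smul]
    by_cases hx : x ∈ closedBall (0 : Space d) ρ'
    · rw [indicator_of_mem hx]
      exact hbd q.1 hq x
    · rw [indicator_of_notMem hx, hsupp q.1 hq x (by rwa [mem_closedBall_zero_iff, not_le] at hx),
        norm_zero]
  · exact (integrableOn_const (measure_closedBall_lt_top.ne)).integrable_indicator
      measurableSet_closedBall
  · refine Eventually.of_forall fun x => ?_
    have h1 : Continuous fun q : ℝ × Space d => (𝐞 (-⟪x, q.2⟫) : Circle) :=
      Real.continuous_fourierChar.comp (continuous_const.inner continuous_snd).neg
    have h2 : ContinuousOn (fun q : ℝ × Space d => f q.1 x) (I ×ˢ univ) :=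
      hcont.comp (continuous_fst.prodMk continuous_const).continuousOn
        fun q hq => ⟨hq.1, mem_univ x⟩
    exact h1.continuousOn.smul h2

/-- **Bound for the Fourier transform of a field supported in a ball**:
`‖𝓕g(ξ)‖ ≤ C |B_{ρ'}|` if `‖g‖ ≤ C` and `g = 0` for `‖x‖ > ρ'`. [folklore] -/
theorem norm_fourier_le_of_support {g : Space d → Fin k → ℂ} {ρ' C : ℝ} (hg : Continuous g)
    (hsupp : ∀ x : Space d, ρ' < ‖x‖ → g x = 0) (hbd : ∀ x, ‖g x‖ ≤ C) (ξ : Space d) :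
    ‖𝓕 g ξ‖ ≤ C * volume.real (closedBall (0 : Space d) ρ') := by
  rw [Real.fourier_eq]
  refine (MeasureTheory.norm_integral_le_integral_norm _).trans ?_
  have hC : ∀ x, ‖(𝐞 (-⟪x, ξ⟫) : Circle) • g x‖ ≤
      (closedBall (0 : Space d) ρ').indicator (fun _ => C) x := by
    intro x
    rw [Circle.norm_smul]
    by_cases hx : x ∈ closedBall (0 : Space d) ρ'
    · rw [indicator_of_mem hx]; exact hbd x
    · rw [indicator_of_notMem hx, hsupp x (by rwa [mem_closedBall_zero_iff, not_le] at hx), norm_zero]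
  have hint : Integrable fun x => ‖(𝐞 (-⟪x, ξ⟫) : Circle) • g x‖ := by
    have hgc : HasCompactSupport g := by
      refine HasCompactSupport.intro (isCompact_closedBall (0 : Space d) ρ') fun x hx => ?_
      rw [mem_closedBall_zero_iff, not_le] at hx
      exact hsupp x hx
    exact (((continuous_fourierKernel ξ).smul hg).norm).integrable_of_hasCompactSupport
      (hgc.smul_left.norm)
  calc ∫ x, ‖(𝐞 (-⟪x, ξ⟫) : Circle) • g x‖
      ≤ ∫ x, (closedBall (0 : Space d) ρ').indicator (fun _ => C) x :=
        integral_mono hint ((integrableOn_const (measure_closedBall_lt_top.ne)).integrable_indicator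
          measurableSet_closedBall) hC
    _ = C * volume.real (closedBall (0 : Space d) ρ') := by
        rw [integral_indicator_const _ measurableSet_closedBall, smul_eq_mul, mul_comm]

/-- **Interval integrability from continuity and a bound on the open interval.** [folklore] -/
theorem intervalIntegrable_of_bound_Ioo {E : Type*} [NormedAddCommGroup E] {F : ℝ → E} {T B : ℝ}
    (hT : 0 ≤ T) (hc : ContinuousOn F (Ioo 0 T)) (hb : ∀ s ∈ Ioo 0 T, ‖F s‖ ≤ B) :
    IntervalIntegrable F volume 0 T := by
  rw [intervalIntegrable_iff_integrableOn_Ioo_of_le hT]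
  have hmeas : AEStronglyMeasurable F (volume.restrict (Ioo 0 T)) :=
    hc.aestronglyMeasurable measurableSet_Ioo
  refine Integrable.mono' (g := fun _ => B) (integrableOn_const (measure_Ioo_lt_top.ne)) hmeas ?_
  exact ae_restrict_of_forall_mem measurableSet_Ioo hb

end Param

/-! ### The forcing slices on the Fourier side -/

section ForcingFourier

variable {S : QuasilinearSystem d k} {ubar : Fin k → ℝ} {u : ℝ → Space d → Fin k → ℝ}
  {T ρ K ε C r : ℝ}

variable (S ubar u) in
/-- The complexified forcing slices `f(s)_ℂ`. [folklore] -/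
def forcingC (s : ℝ) : Space d → Fin k → ℂ := cplx fun y => forcing S ubar u (s, y)

variable (S ubar u) in
/-- The complexified `j`-th derivative slices `(∂ⱼf)(s)_ℂ`. [folklore] -/
def forcingDjC (j : Fin d) (s : ℝ) : Space d → Fin k → ℂ :=
  cplx fun y => fderiv ℝ (forcing S ubar u) (s, y) (0, EuclideanSpace.single j 1)

/-- The forcing slices are continuous on the open slab. [folklore] -/
theorem continuousOn_uncurry_forcingC (h2 : ContDiffOn ℝ 2 (Function.uncurry u) (Icc 0 T ×ˢ univ)) :
    ContinuousOn (Function.uncurry (forcingC S ubar u)) (Ioo 0 T ×ˢ univ) := by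
  have h : Function.uncurry (forcingC S ubar u) = ofRealPi ∘ forcing S ubar u := by
    funext p; rfl
  rw [h]
  exact ofRealPi.continuous.comp_continuousOn (contDiffOn_forcing h2).continuousOn

/-- The derivative slices are continuous on the open slab. [folklore] -/
theorem continuousOn_uncurry_forcingDjC (h2 : ContDiffOn ℝ 2 (Function.uncurry u) (Icc 0 T ×ˢ univ))
    (j : Fin d) : ContinuousOn (Function.uncurry (forcingDjC S ubar u j)) (Ioo 0 T ×ˢ univ) := by
  have hD : ContinuousOn (fderiv ℝ (forcing S ubar u)) (Ioo 0 T ×ˢ univ) :=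
    (contDiffOn_forcing h2).continuousOn_fderiv_of_isOpen (isOpen_openSlab T) le_rfl
  have h : Function.uncurry (forcingDjC S ubar u j) = ofRealPi ∘ fun p =>
      fderiv ℝ (forcing S ubar u) p (0, EuclideanSpace.single j 1) := by
    funext p; rfl
  rw [h]
  exact ofRealPi.continuous.comp_continuousOn
    ((ContinuousLinearMap.apply ℝ (Fin k → ℝ) ((0 : ℝ), EuclideanSpace.single j (1 : ℝ))).continuous
      |>.comp_continuousOn hD)

/-- The derivative of the forcing vanishes on the open exterior region. [folklore] -/
theorem fderiv_forcing_eq_zero (hsupp : ∀ t ∈ Icc 0 T, ∀ x : Space d, ρ < ‖x‖ → u t x = ubar)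
    {p : ℝ × Space d} (hp : p.1 ∈ Ioo 0 T) (hx : ρ < ‖p.2‖) : fderiv ℝ (forcing S ubar u) p = 0 := by
  have ho : IsOpen (Ioo 0 T ×ˢ {y : Space d | ρ < ‖y‖}) :=
    isOpen_Ioo.prod (isOpen_lt continuous_const continuous_norm)
  have heq : forcing S ubar u =ᶠ[𝓝 p] fun _ => 0 :=
    Filter.eventuallyEq_of_mem (ho.mem_nhds ⟨hp, hx⟩) fun q hq => forcing_eq_zero hsupp hq.1 hq.2
  rw [heq.fderiv_eq, fderiv_const_apply]

/-- Support of the forcing slices. [folklore] -/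
theorem forcingC_eq_zero (hsupp : ∀ t ∈ Icc 0 T, ∀ x : Space d, ρ < ‖x‖ → u t x = ubar) :
    ∀ s ∈ Ioo 0 T, ∀ x : Space d, ρ < ‖x‖ → forcingC S ubar u s x = 0 := fun s hs x hx => by
  rw [forcingC, cplx_apply, forcing_eq_zero hsupp (p := (s, x)) hs hx, map_zero]

/-- Support of the derivative slices. [folklore] -/
theorem forcingDjC_eq_zero (hsupp : ∀ t ∈ Icc 0 T, ∀ x : Space d, ρ < ‖x‖ → u t x = ubar)
    (j : Fin d) : ∀ s ∈ Ioo 0 T, ∀ x : Space d, ρ < ‖x‖ → forcingDjC S ubar u j s x = 0 :=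
  fun s hs x hx => by
  rw [forcingDjC, cplx_apply, fderiv_forcing_eq_zero hsupp (p := (s, x)) hs hx,
    _root_.zero_apply, map_zero]

/-- **The standing hypotheses on the solution family**: `C²` on the slab, equal to `ū` for
`‖x‖ > ρ`, and `O(ε)`-close to `ū` in `C²` on the open slab; together with the quadratic
bounds for `Φ` on the ball of radius `r ≥ Kε`. (A structure to keep the signatures short; it
quantifies over nothing new.) [cite: Rauch1986, Local Existence Theorem p. 482] -/
structure SmallSol (S : QuasilinearSystem d k) (ubar : Fin k → ℝ) (u : ℝ → Space d → Fin k → ℝ)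
    (T ρ K ε C r : ℝ) : Prop where
  contDiffOn : ContDiffOn ℝ 2 (Function.uncurry u) (Icc 0 T ×ˢ univ)
  supp : ∀ t ∈ Icc 0 T, ∀ x : Space d, ρ < ‖x‖ → u t x = ubar
  Kε_nonneg : 0 ≤ K * ε
  C_nonneg : 0 ≤ C
  quad : ∀ y : DerivData d k, ‖y‖ ≤ r →
    ‖fderiv ℝ (remainderMap S ubar) y‖ ≤ C * ‖y‖ ∧ ‖remainderMap S ubar y‖ ≤ C * ‖y‖ ^ 2
  Kε_le : K * ε ≤ r
  b0 : ∀ p : ℝ × Space d, p.1 ∈ Ioo 0 T → ‖u p.1 p.2 - ubar‖ ≤ K * ε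
  b1 : ∀ p : ℝ × Space d, p.1 ∈ Ioo 0 T → ‖fderiv ℝ (Function.uncurry u) p‖ ≤ K * ε
  b2 : ∀ p : ℝ × Space d, p.1 ∈ Ioo 0 T →
    ‖fderiv ℝ (fun q => fderiv ℝ (Function.uncurry u) q) p‖ ≤ K * ε

/-- Bound for the forcing slices: `‖f(s)_ℂ(x)‖ ≤ C(Kε)²`. [folklore] -/
theorem SmallSol.norm_forcingC_le (h : SmallSol S ubar u T ρ K ε C r) {s : ℝ} (hs : s ∈ Ioo 0 T)
    (x : Space d) : ‖forcingC S ubar u s x‖ ≤ C * (K * ε) ^ 2 := by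
  rw [forcingC, cplx_apply, norm_ofRealPi]
  exact (norm_forcing_le h.contDiffOn h.Kε_nonneg h.C_nonneg h.quad h.Kε_le h.b0 h.b1 h.b2
    (p := (s, x)) hs).1

/-- Bound for the derivative slices: `‖(∂ⱼf)(s)_ℂ(x)‖ ≤ C(Kε)²`. [folklore] -/
theorem SmallSol.norm_forcingDjC_le (h : SmallSol S ubar u T ρ K ε C r) (j : Fin d) {s : ℝ}
    (hs : s ∈ Ioo 0 T) (x : Space d) : ‖forcingDjC S ubar u j s x‖ ≤ C * (K * ε) ^ 2 := by
  rw [forcingDjC, cplx_apply, norm_ofRealPi]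
  have hb := (norm_forcing_le h.contDiffOn h.Kε_nonneg h.C_nonneg h.quad h.Kε_le h.b0 h.b1 h.b2
    (p := (s, x)) hs).2
  calc ‖fderiv ℝ (forcing S ubar u) (s, x) (0, EuclideanSpace.single j 1)‖
      ≤ ‖fderiv ℝ (forcing S ubar u) (s, x)‖ * ‖((0 : ℝ), EuclideanSpace.single j (1 : ℝ))‖ :=
        ContinuousLinearMap.le_opNorm _ _
    _ ≤ C * (K * ε) ^ 2 := by rw [norm_zero_single, mul_one]; exact hb

/-- **Joint continuity of `(s, ξ) ↦ 𝓕[f(s)_ℂ](ξ)` on the open slab.** [folklore] -/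
theorem SmallSol.continuousOn_fourier_forcingC (h : SmallSol S ubar u T ρ K ε C r) :
    ContinuousOn (fun q : ℝ × Space d => 𝓕 (forcingC S ubar u q.1) q.2) (Ioo 0 T ×ˢ univ) :=
  continuousOn_fourier_param (continuousOn_uncurry_forcingC h.contDiffOn) (forcingC_eq_zero h.supp)
    fun _ hs x => h.norm_forcingC_le hs x

/-- **Joint continuity of `(s, ξ) ↦ 𝓕[(∂ⱼf)(s)_ℂ](ξ)` on the open slab.** [folklore] -/
theorem SmallSol.continuousOn_fourier_forcingDjC (h : SmallSol S ubar u T ρ K ε C r) (j : Fin d) :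
    ContinuousOn (fun q : ℝ × Space d => 𝓕 (forcingDjC S ubar u j q.1) q.2) (Ioo 0 T ×ˢ univ) :=
  continuousOn_fourier_param (continuousOn_uncurry_forcingDjC h.contDiffOn j)
    (forcingDjC_eq_zero h.supp j) fun _ hs x => h.norm_forcingDjC_le j hs x

/-- The forcing slice at an interior time is `C¹` on `ℝᵈ`. [folklore] -/
theorem contDiff_forcing_slice (h2 : ContDiffOn ℝ 2 (Function.uncurry u) (Icc 0 T ×ˢ univ))
    {s : ℝ} (hs : s ∈ Ioo 0 T) : ContDiff ℝ 1 fun y : Space d => forcing S ubar u (s, y) := by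
  refine contDiff_iff_contDiffAt.2 fun y => ?_
  have hf : ContDiffAt ℝ 1 (forcing S ubar u) (s, y) :=
    (contDiffOn_forcing h2).contDiffAt ((isOpen_openSlab T).mem_nhds ⟨hs, mem_univ y⟩)
  exact hf.comp y (contDiffAt_const.prodMk contDiffAt_id)

/-- **`𝓕[(∂ⱼf)(s)_ℂ] = 2πiξⱼ 𝓕[f(s)_ℂ]`** at interior times. [folklore] -/
theorem SmallSol.fourier_forcingDjC_eq (h : SmallSol S ubar u T ρ K ε C r) (j : Fin d) {s : ℝ}
    (hs : s ∈ Ioo 0 T) (ξ : Space d) :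
    𝓕 (forcingDjC S ubar u j s) ξ = (2 * Real.pi * ξ j * Complex.I) • 𝓕 (forcingC S ubar u s) ξ := by
  have hg : ContDiff ℝ 1 (forcingC S ubar u s) := (contDiff_forcing_slice h.contDiffOn hs).cplx
  have hgc : HasCompactSupport (forcingC S ubar u s) := by
    refine HasCompactSupport.intro (isCompact_closedBall (0 : Space d) ρ) fun x hx => ?_
    rw [mem_closedBall_zero_iff, not_le] at hx
    exact forcingC_eq_zero h.supp s hs x hx
  have hfun : forcingDjC S ubar u j s =
      fun y => fderiv ℝ (forcingC S ubar u s) y (EuclideanSpace.single j 1) := by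
    funext y
    have hd : DifferentiableAt ℝ (fun y : Space d => forcing S ubar u (s, y)) y :=
      ((contDiff_forcing_slice h.contDiffOn hs).differentiable one_ne_zero).differentiableAt
    have hD : DifferentiableAt ℝ (forcing S ubar u) (s, y) :=
      ((contDiffOn_forcing h.contDiffOn).contDiffAt
        ((isOpen_openSlab T).mem_nhds ⟨hs, mem_univ y⟩)).differentiableAt one_ne_zero
    rw [forcingC, fderiv_cplx_apply hd, fderiv_slab_slice_apply (q := (s, y)) hD, forcingDjC,
      cplx_apply]
  rw [hfun, fourier_fderiv_apply_single hg hgc ξ j]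

/-- Bound for `𝓕[f(s)_ℂ]`: `‖𝓕[f(s)_ℂ](ξ)‖ ≤ C(Kε)² |B_ρ|`. [folklore] -/
theorem SmallSol.norm_fourier_forcingC_le (h : SmallSol S ubar u T ρ K ε C r) {s : ℝ}
    (hs : s ∈ Ioo 0 T) (ξ : Space d) :
    ‖𝓕 (forcingC S ubar u s) ξ‖ ≤ C * (K * ε) ^ 2 * volume.real (closedBall (0 : Space d) ρ) :=
  norm_fourier_le_of_support (ofRealPi.continuous.comp (contDiff_forcing_slice h.contDiffOn hs).continuous)
    (forcingC_eq_zero h.supp s hs) (fun x => h.norm_forcingC_le hs x) ξ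

end ForcingFourier

/-! ### Duhamel's formula for `Ŵ` and the Fourier-side bound -/

section DuhamelBound

variable {S : QuasilinearSystem d k} {ubar : Fin k → ℝ} {u : ℝ → Space d → Fin k → ℝ}
  {T ρ K ε C r : ℝ} {φ : Space d → Fin k → ℝ}

/-- `e^{sG} = M_{-s}`. [folklore] -/
theorem exp_smul_eq_rauchSymbol_neg (A₀ : Matrix (Fin k) (Fin k) ℝ) (A : Fin d → Matrix (Fin k) (Fin k) ℝ)
    (B₁ : (Fin k → ℝ) →L[ℝ] (Fin k → ℝ)) (s : ℝ) (ξ : Space d) :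
    NormedSpace.exp (s • rauchGenerator A₀ A B₁ ξ) = rauchSymbol A₀ A B₁ (-s) ξ := by
  rw [rauchSymbol, Complex.ofReal_neg, neg_neg, Complex.coe_smul]

/-- `M_T e^{TG} = 1`. [folklore] -/
theorem rauchSymbol_mul_exp (A₀ : Matrix (Fin k) (Fin k) ℝ) (A : Fin d → Matrix (Fin k) (Fin k) ℝ)
    (B₁ : (Fin k → ℝ) →L[ℝ] (Fin k → ℝ)) (T : ℝ) (ξ : Space d) :
    rauchSymbol A₀ A B₁ T ξ * NormedSpace.exp (T • rauchGenerator A₀ A B₁ ξ) = 1 := by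
  rw [rauchSymbol, ← Complex.coe_smul,
    ← Matrix.exp_add_of_commute _ _ (((Commute.refl _).smul_left _).smul_right _), ← add_smul,
    neg_add_cancel, zero_smul, NormedSpace.exp_zero]

/-- Restriction of a field continuous on `I × ℝᵈ` to the line `I × {ξ}`. [folklore] -/
theorem continuousOn_along_fst {E : Type*} [TopologicalSpace E] {F : ℝ × Space d → E} {I : Set ℝ}
    (hF : ContinuousOn F (I ×ˢ univ)) (ξ : Space d) : ContinuousOn (fun s => F (s, ξ)) I :=
  hF.comp (continuous_id.prodMk continuous_const).continuousOn fun _ hs => ⟨hs, mem_univ ξ⟩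

/-- `s ↦ 𝓕[f(s)_ℂ](ξ)` is continuous on `(0, T)`. [folklore] -/
theorem SmallSol.continuousOn_fourier_forcingC_fst (h : SmallSol S ubar u T ρ K ε C r) (ξ : Space d) :
    ContinuousOn (fun s => 𝓕 (forcingC S ubar u s) ξ) (Ioo 0 T) :=
  continuousOn_along_fst (F := fun q : ℝ × Space d => 𝓕 (forcingC S ubar u q.1) q.2)
    h.continuousOn_fourier_forcingC ξ

/-- **The Duhamel integrand** `Ψ(s) = e^{sG}A₀⁻¹_ℂ 𝓕[f(s)_ℂ](ξ)` is interval integrable on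
`[0, T]` (continuous on `(0, T)`, bounded by `kC₀‖A₀⁻¹_ℂ‖ C(Kε)²|B_ρ|`). [folklore] -/
theorem SmallSol.intervalIntegrable_duhamel (h : SmallSol S ubar u T ρ K ε C r) (hT : 0 < T)
    {C₀ : ℝ} (hC0 : 0 ≤ C₀) (hC₀ : ∀ t : ℝ, |t| ≤ T → ∀ (ξ : Space d) (a b : Fin k),
      ‖rauchSymbol (S.A0 ubar) (fun j => S.A j ubar) (fderiv ℝ S.B ubar) t ξ a b‖ ≤ C₀)
    (ξ : Space d) :
    IntervalIntegrable (fun s => NormedSpace.exp (s • rauchGenerator (S.A0 ubar) (fun j => S.A j ubar)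
      (fderiv ℝ S.B ubar) ξ) *ᵥ (((S.A0 ubar)⁻¹).map (algebraMap ℝ ℂ) *ᵥ 𝓕 (forcingC S ubar u s) ξ))
      volume 0 T := by
  refine intervalIntegrable_of_bound_Ioo hT.le ?_ (B := k * C₀ * (‖((S.A0 ubar)⁻¹).map (algebraMap ℝ ℂ)‖ *
    (C * (K * ε) ^ 2 * volume.real (closedBall (0 : Space d) ρ)))) ?_
  · have h1 : Continuous fun s : ℝ => NormedSpace.exp (s • rauchGenerator (S.A0 ubar)
        (fun j => S.A j ubar) (fderiv ℝ S.B ubar) ξ) :=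
      NormedSpace.exp_continuous.comp (continuous_id.smul continuous_const)
    have h2 : ContinuousOn (fun s => ((S.A0 ubar)⁻¹).map (algebraMap ℝ ℂ) *ᵥ 𝓕 (forcingC S ubar u s) ξ)
        (Ioo 0 T) :=
      ((mulVecBilin (k := k)).continuous₂.comp_continuousOn
        (continuousOn_const.prodMk (h.continuousOn_fourier_forcingC_fst ξ)) :)
    exact ((mulVecBilin (k := k)).continuous₂.comp_continuousOn (h1.continuousOn.prodMk h2) :)
  · intro s hs
    rw [exp_smul_eq_rauchSymbol_neg]
    have hs' : |(-s)| ≤ T := by rw [abs_neg, abs_of_pos hs.1]; exact hs.2.le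
    refine (norm_rauchSymbol_mulVec_le hC0 (hC₀ (-s) hs') _ ξ).trans ?_
    refine mul_le_mul_of_nonneg_left ?_ (by positivity)
    exact (Matrix.linfty_opNorm_mulVec _ _).trans (mul_le_mul_of_nonneg_left
      (h.norm_fourier_forcingC_le hs ξ) (norm_nonneg _))

/-- **Duhamel's formula for `Ŵ`**: `e^{TG}Ŵ(T) = ∫₀ᵀ e^{sG}A₀⁻¹_ℂ𝓕[f(s)_ℂ] ds` (`Ŵ(0) = 0`).
[cite: Rauch1986, Proof of Theorem p. 482; Brenner1973, Lemma 5.1 p. 96] -/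
theorem SmallSol.exp_mulVec_remF_eq (h : SmallSol S ubar u T ρ K ε C r) (hS : S.IsRauchClass ubar)
    (hu : S.IsClassicalSolution T u) (hT : 0 < T) (h0 : ∀ x, u 0 x = ubar + ε • φ x)
    {C₀ : ℝ} (hC0 : 0 ≤ C₀) (hC₀ : ∀ t : ℝ, |t| ≤ T → ∀ (ξ : Space d) (a b : Fin k),
      ‖rauchSymbol (S.A0 ubar) (fun j => S.A j ubar) (fderiv ℝ S.B ubar) t ξ a b‖ ≤ C₀)
    (ξ : Space d) :
    NormedSpace.exp (T • rauchGenerator (S.A0 ubar) (fun j => S.A j ubar) (fderiv ℝ S.B ubar) ξ) *ᵥ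
        remF S ubar u φ ε T ξ =
      ∫ s in (0 : ℝ)..T, NormedSpace.exp (s • rauchGenerator (S.A0 ubar) (fun j => S.A j ubar)
        (fderiv ℝ S.B ubar) ξ) *ᵥ (((S.A0 ubar)⁻¹).map (algebraMap ℝ ℂ) *ᵥ 𝓕 (forcingC S ubar u s) ξ) := by
  have hWd : ∀ t ∈ Ioo 0 T, HasDerivAt (fun s => remF S ubar u φ ε s ξ)
      (-(rauchGenerator (S.A0 ubar) (fun j => S.A j ubar) (fderiv ℝ S.B ubar) ξ *ᵥ
          remF S ubar u φ ε t ξ) +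
        ((S.A0 ubar)⁻¹).map (algebraMap ℝ ℂ) *ᵥ 𝓕 (forcingC S ubar u t) ξ) t :=
    fun t ht => hasDerivAt_remF hS hu h.contDiffOn h.supp φ ε ht ξ
  have hD := duhamel_mulVec hT.le (continuousOn_remF hu h.supp φ ε ξ) hWd
    (h.intervalIntegrable_duhamel hT hC0 hC₀ ξ)
  rw [remF_zero h0, sub_zero] at hD
  exact hD

/-- `s ↦ 2πiξⱼ 𝓕[f(s)_ℂ](ξ)` is interval integrable on `[0, T]`, and so is its squared norm.
[folklore] -/
theorem SmallSol.intervalIntegrable_smul_fourier_forcingC (h : SmallSol S ubar u T ρ K ε C r)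
    (hT : 0 < T) (c : ℂ) (ξ : Space d) :
    IntervalIntegrable (fun s => ‖c • 𝓕 (forcingC S ubar u s) ξ‖) volume 0 T ∧
      IntervalIntegrable (fun s => ‖c • 𝓕 (forcingC S ubar u s) ξ‖ ^ 2) volume 0 T := by
  have hc : ContinuousOn (fun s => ‖c • 𝓕 (forcingC S ubar u s) ξ‖) (Ioo 0 T) :=
    ((continuousOn_const (c := c)).smul (h.continuousOn_fourier_forcingC_fst ξ)).norm
  have hb : ∀ s ∈ Ioo 0 T, ‖c • 𝓕 (forcingC S ubar u s) ξ‖ ≤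
      ‖c‖ * (C * (K * ε) ^ 2 * volume.real (closedBall (0 : Space d) ρ)) := fun s hs => by
    rw [norm_smul]
    exact mul_le_mul_of_nonneg_left (h.norm_fourier_forcingC_le hs ξ) (norm_nonneg _)
  refine ⟨intervalIntegrable_of_bound_Ioo (B := ‖c‖ * (C * (K * ε) ^ 2 *
      volume.real (closedBall (0 : Space d) ρ))) hT.le hc (fun s hs => ?_),
    intervalIntegrable_of_bound_Ioo (B := (‖c‖ * (C * (K * ε) ^ 2 *
      volume.real (closedBall (0 : Space d) ρ))) ^ 2) hT.le (hc.pow 2) (fun s hs => ?_)⟩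
  · rw [Real.norm_eq_abs, abs_of_nonneg (norm_nonneg _)]
    exact hb s hs
  · rw [Real.norm_eq_abs, abs_of_nonneg (sq_nonneg _)]
    exact pow_le_pow_left₀ (norm_nonneg _) (hb s hs) 2

/-- **The Fourier-side bound for the remainder gradient**:
`‖2πiξⱼ Ŵ(T, ξ)‖ ≤ kC₀ · kC₀‖A₀⁻¹_ℂ‖ · ∫₀ᵀ ‖2πiξⱼ 𝓕[f(s)_ℂ](ξ)‖ ds` — from Duhamel,
`Ŵ(T) = M_T ∫₀ᵀ Ψ`, and Brenner's bound for `M_T` and `e^{sG} = M_{-s}`.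
[cite: Rauch1986, Proof of Theorem pp. 482–483; Brenner1973, (0.3) p. 75] -/
theorem SmallSol.norm_smul_remF_le (h : SmallSol S ubar u T ρ K ε C r) (hS : S.IsRauchClass ubar)
    (hu : S.IsClassicalSolution T u) (hT : 0 < T) (h0 : ∀ x, u 0 x = ubar + ε • φ x)
    {C₀ : ℝ} (hC0 : 0 ≤ C₀) (hC₀ : ∀ t : ℝ, |t| ≤ T → ∀ (ξ : Space d) (a b : Fin k),
      ‖rauchSymbol (S.A0 ubar) (fun j => S.A j ubar) (fderiv ℝ S.B ubar) t ξ a b‖ ≤ C₀)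
    (c : ℂ) (ξ : Space d) :
    ‖c • remF S ubar u φ ε T ξ‖ ≤ (k * C₀) * ((k * C₀) * ‖((S.A0 ubar)⁻¹).map (algebraMap ℝ ℂ)‖) *
      ∫ s in (0 : ℝ)..T, ‖c • 𝓕 (forcingC S ubar u s) ξ‖ := by
  set G := rauchGenerator (S.A0 ubar) (fun j => S.A j ubar) (fderiv ℝ S.B ubar) ξ with hG
  set Minv := ((S.A0 ubar)⁻¹).map (algebraMap ℝ ℂ) with hMinv
  set Ψ : ℝ → Fin k → ℂ := fun s => NormedSpace.exp (s • G) *ᵥ (Minv *ᵥ 𝓕 (forcingC S ubar u s) ξ)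
    with hΨ
  have hD : NormedSpace.exp (T • G) *ᵥ remF S ubar u φ ε T ξ = ∫ s in (0 : ℝ)..T, Ψ s :=
    h.exp_mulVec_remF_eq hS hu hT h0 hC0 hC₀ ξ
  have hΨi : IntervalIntegrable Ψ volume 0 T := h.intervalIntegrable_duhamel hT hC0 hC₀ ξ
  -- `Ŵ(T) = M_T ∫ Ψ`
  have hW : remF S ubar u φ ε T ξ =
      rauchSymbol (S.A0 ubar) (fun j => S.A j ubar) (fderiv ℝ S.B ubar) T ξ *ᵥ ∫ s in (0 : ℝ)..T, Ψ s := by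
    rw [← hD, mulVec_mulVec, rauchSymbol_mul_exp, one_mulVec]
  have hcW : c • remF S ubar u φ ε T ξ =
      rauchSymbol (S.A0 ubar) (fun j => S.A j ubar) (fderiv ℝ S.B ubar) T ξ *ᵥ
        ∫ s in (0 : ℝ)..T, c • Ψ s := by
    rw [hW, ← mulVec_smul, intervalIntegral.integral_smul]
  rw [hcW]
  have hTabs : |T| ≤ T := by rw [abs_of_pos hT]
  -- pointwise: `‖c Ψ(s)‖ = ‖M_{-s} A₀⁻¹ (c 𝓕f)‖ ≤ kC₀ ‖A₀⁻¹‖ ‖c 𝓕f‖`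
  have hpt : ∀ s ∈ Icc 0 T, ‖c • Ψ s‖ ≤ (k * C₀ * ‖Minv‖) * ‖c • 𝓕 (forcingC S ubar u s) ξ‖ := by
    intro s hs
    have hs' : |(-s)| ≤ T := by rw [abs_neg, abs_of_nonneg hs.1]; exact hs.2
    rw [hΨ]
    dsimp only
    rw [← mulVec_smul, ← mulVec_smul, exp_smul_eq_rauchSymbol_neg]
    refine (norm_rauchSymbol_mulVec_le hC0 (hC₀ (-s) hs') _ ξ).trans ?_
    rw [mul_assoc (k * C₀)]
    refine mul_le_mul_of_nonneg_left ?_ (by positivity)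
    exact Matrix.linfty_opNorm_mulVec _ _
  have hI1 : ‖∫ s in (0 : ℝ)..T, c • Ψ s‖ ≤ ∫ s in (0 : ℝ)..T, ‖c • Ψ s‖ :=
    intervalIntegral.norm_integral_le_integral_norm hT.le
  have hI2 : ∫ s in (0 : ℝ)..T, ‖c • Ψ s‖ ≤
      ∫ s in (0 : ℝ)..T, (k * C₀ * ‖Minv‖) * ‖c • 𝓕 (forcingC S ubar u s) ξ‖ :=
    intervalIntegral.integral_mono_on hT.le (hΨi.smul c).norm
      ((h.intervalIntegrable_smul_fourier_forcingC hT c ξ).1.const_mul _) hpt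
  rw [intervalIntegral.integral_const_mul] at hI2
  calc ‖rauchSymbol (S.A0 ubar) (fun j => S.A j ubar) (fderiv ℝ S.B ubar) T ξ *ᵥ
          ∫ s in (0 : ℝ)..T, c • Ψ s‖
      ≤ k * C₀ * ‖∫ s in (0 : ℝ)..T, c • Ψ s‖ := norm_rauchSymbol_mulVec_le hC0 (hC₀ T hTabs) _ ξ
    _ ≤ k * C₀ * ((k * C₀ * ‖Minv‖) * ∫ s in (0 : ℝ)..T, ‖c • 𝓕 (forcingC S ubar u s) ξ‖) :=
        mul_le_mul_of_nonneg_left (hI1.trans hI2) (by positivity)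
    _ = _ := by ring

/-- **Squared form with Cauchy–Schwarz in time**:
`‖2πiξⱼ Ŵ(T, ξ)‖² ≤ K₁² T ∫₀ᵀ ‖2πiξⱼ 𝓕[f(s)_ℂ](ξ)‖² ds`. [folklore] -/
theorem SmallSol.sq_norm_smul_remF_le (h : SmallSol S ubar u T ρ K ε C r) (hS : S.IsRauchClass ubar)
    (hu : S.IsClassicalSolution T u) (hT : 0 < T) (h0 : ∀ x, u 0 x = ubar + ε • φ x)
    {C₀ : ℝ} (hC0 : 0 ≤ C₀) (hC₀ : ∀ t : ℝ, |t| ≤ T → ∀ (ξ : Space d) (a b : Fin k),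
      ‖rauchSymbol (S.A0 ubar) (fun j => S.A j ubar) (fderiv ℝ S.B ubar) t ξ a b‖ ≤ C₀)
    (c : ℂ) (ξ : Space d) :
    ‖c • remF S ubar u φ ε T ξ‖ ^ 2 ≤
      ((k * C₀) * ((k * C₀) * ‖((S.A0 ubar)⁻¹).map (algebraMap ℝ ℂ)‖)) ^ 2 *
        (T * ∫ s in (0 : ℝ)..T, ‖c • 𝓕 (forcingC S ubar u s) ξ‖ ^ 2) := by
  have h1 := h.norm_smul_remF_le hS hu hT h0 hC0 hC₀ c ξ
  obtain ⟨ha, ha2⟩ := h.intervalIntegrable_smul_fourier_forcingC hT c ξ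
  have hCS := sq_integral_le_mul_integral_sq hT.le ha ha2
  have hI0 : 0 ≤ ∫ s in (0 : ℝ)..T, ‖c • 𝓕 (forcingC S ubar u s) ξ‖ :=
    intervalIntegral.integral_nonneg hT.le fun s _ => norm_nonneg _
  calc ‖c • remF S ubar u φ ε T ξ‖ ^ 2
      ≤ (((k * C₀) * ((k * C₀) * ‖((S.A0 ubar)⁻¹).map (algebraMap ℝ ℂ)‖)) *
          ∫ s in (0 : ℝ)..T, ‖c • 𝓕 (forcingC S ubar u s) ξ‖) ^ 2 :=
        pow_le_pow_left₀ (norm_nonneg _) h1 2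
    _ = ((k * C₀) * ((k * C₀) * ‖((S.A0 ubar)⁻¹).map (algebraMap ℝ ℂ)‖)) ^ 2 *
          (∫ s in (0 : ℝ)..T, ‖c • 𝓕 (forcingC S ubar u s) ξ‖) ^ 2 := by rw [mul_pow]
    _ ≤ _ := mul_le_mul_of_nonneg_left hCS (sq_nonneg _)

end DuhamelBound

/-! ### Fubini and Plancherel: the `L²(dξ)` bound for `2πiξⱼ Ŵ(T)` -/

section Fubini

variable {S : QuasilinearSystem d k} {ubar : Fin k → ℝ} {u : ℝ → Space d → Fin k → ℝ}
  {T ρ K ε C r : ℝ} {φ : Space d → Fin k → ℝ}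

/-- Swapping the factors of a field continuous on `I × ℝᵈ`. [folklore] -/
theorem continuousOn_swap {E : Type*} [TopologicalSpace E] {F : ℝ × Space d → E} {I : Set ℝ}
    (hF : ContinuousOn F (I ×ˢ univ)) : ContinuousOn (fun z : Space d × ℝ => F (z.2, z.1)) (univ ×ˢ I) :=
  hF.comp (continuous_snd.prodMk continuous_fst).continuousOn fun _ hz => ⟨hz.2, mem_univ _⟩

/-- The derivative slice `(∂ⱼf)(s)_ℂ` at an interior time is continuous and vanishes outside
the ball of radius `ρ`. [folklore] -/
theorem SmallSol.continuous_forcingDjC (h : SmallSol S ubar u T ρ K ε C r) (j : Fin d) {s : ℝ}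
    (hs : s ∈ Ioo 0 T) : Continuous (forcingDjC S ubar u j s) ∧ HasCompactSupport (forcingDjC S ubar u j s) := by
  refine ⟨((continuousOn_uncurry_forcingDjC h.contDiffOn j).comp_continuous
    (continuous_const.prodMk continuous_id) fun x => ⟨hs, mem_univ x⟩ :), ?_⟩
  refine HasCompactSupport.intro (isCompact_closedBall (0 : Space d) ρ) fun x hx => ?_
  rw [mem_closedBall_zero_iff, not_le] at hx
  exact forcingDjC_eq_zero h.supp j s hs x hx

/-- **Plancherel for the derivative slices**: `∫ ‖𝓕[(∂ⱼf)(s)_ℂ]‖² ≤ k (C(Kε)²)² |B_ρ|`.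
[cite: Titchmarsh1948, Thm. 48] -/
theorem SmallSol.integral_norm_sq_fourier_forcingDjC_le (h : SmallSol S ubar u T ρ K ε C r) (j : Fin d)
    {s : ℝ} (hs : s ∈ Ioo 0 T) :
    Integrable (fun ξ => ‖𝓕 (forcingDjC S ubar u j s) ξ‖ ^ 2) ∧
      ∫ ξ, ‖𝓕 (forcingDjC S ubar u j s) ξ‖ ^ 2 ≤
        k * ((C * (K * ε) ^ 2) ^ 2 * volume.real (closedBall (0 : Space d) ρ)) := by
  obtain ⟨hgc, hgs⟩ := h.continuous_forcingDjC j hs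
  obtain ⟨hint, hle⟩ := integral_norm_sq_fourier_le hgc hgs
  refine ⟨hint, hle.trans (mul_le_mul_of_nonneg_left ?_ (Nat.cast_nonneg k))⟩
  have hpt : ∀ x, ‖forcingDjC S ubar u j s x‖ ^ 2 ≤
      (closedBall (0 : Space d) ρ).indicator (fun _ => (C * (K * ε) ^ 2) ^ 2) x := by
    intro x
    by_cases hx : x ∈ closedBall (0 : Space d) ρ
    · rw [indicator_of_mem hx]
      exact pow_le_pow_left₀ (norm_nonneg _) (h.norm_forcingDjC_le j hs x) 2
    · rw [indicator_of_notMem hx, forcingDjC_eq_zero h.supp j s hs x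
        (by rwa [mem_closedBall_zero_iff, not_le] at hx), norm_zero]
      norm_num
  calc ∫ x, ‖forcingDjC S ubar u j s x‖ ^ 2
      ≤ ∫ x, (closedBall (0 : Space d) ρ).indicator (fun _ => (C * (K * ε) ^ 2) ^ 2) x :=
        integral_mono (integrable_norm_sq_of_hasCompactSupport hgc hgs)
          ((integrableOn_const (measure_closedBall_lt_top.ne)).integrable_indicator
            measurableSet_closedBall) hpt
    _ = (C * (K * ε) ^ 2) ^ 2 * volume.real (closedBall (0 : Space d) ρ) := by
        rw [integral_indicator_const _ measurableSet_closedBall, smul_eq_mul, mul_comm]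

/-- **Integrability on the product `ℝᵈ × (0, T)`** of `(ξ, s) ↦ ‖𝓕[(∂ⱼf)(s)_ℂ](ξ)‖²`
(joint continuity, slice integrability by Plancherel, and the uniform slice bound).
[folklore] -/
theorem SmallSol.integrable_prod (h : SmallSol S ubar u T ρ K ε C r) (j : Fin d) :
    Integrable (fun z : Space d × ℝ => ‖𝓕 (forcingDjC S ubar u j z.2) z.1‖ ^ 2)
      ((volume : Measure (Space d)).prod (volume.restrict (Ioo 0 T))) := by
  -- joint continuity on `ℝᵈ × (0, T)`
  have hcont : ContinuousOn (fun z : Space d × ℝ => ‖𝓕 (forcingDjC S ubar u j z.2) z.1‖ ^ 2)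
      (univ ×ˢ Ioo 0 T) := by
    have h1 : ContinuousOn (fun z : Space d × ℝ => 𝓕 (forcingDjC S ubar u j z.2) z.1) (univ ×ˢ Ioo 0 T) :=
      continuousOn_swap (F := fun q : ℝ × Space d => 𝓕 (forcingDjC S ubar u j q.1) q.2)
        (h.continuousOn_fourier_forcingDjC j)
    exact h1.norm.pow 2
  have hμ : (volume : Measure (Space d)).prod (volume.restrict (Ioo 0 T)) =
      ((volume : Measure (Space d)).prod (volume : Measure ℝ)).restrict (univ ×ˢ Ioo 0 T) := by
    rw [← Measure.prod_restrict, Measure.restrict_univ]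
  have hmeas : AEStronglyMeasurable (fun z : Space d × ℝ => ‖𝓕 (forcingDjC S ubar u j z.2) z.1‖ ^ 2)
      ((volume : Measure (Space d)).prod (volume.restrict (Ioo 0 T))) := by
    rw [hμ]
    exact hcont.aestronglyMeasurable (MeasurableSet.univ.prod measurableSet_Ioo)
  refine (integrable_prod_iff' hmeas).2 ⟨?_, ?_⟩
  · exact ae_restrict_of_forall_mem measurableSet_Ioo fun s hs =>
      (h.integral_norm_sq_fourier_forcingDjC_le j hs).1
  · refine Integrable.mono' (g := fun _ => k * ((C * (K * ε) ^ 2) ^ 2 *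
      volume.real (closedBall (0 : Space d) ρ)))
      (integrableOn_const (measure_Ioo_lt_top.ne)) hmeas.prod_swap.norm.integral_prod_right'
      (ae_restrict_of_forall_mem measurableSet_Ioo fun s hs => ?_)
    have hnn : 0 ≤ ∫ ξ, ‖‖𝓕 (forcingDjC S ubar u j s) ξ‖ ^ 2‖ := integral_nonneg fun _ => norm_nonneg _
    rw [Real.norm_of_nonneg hnn]
    have heq : (fun ξ => ‖‖𝓕 (forcingDjC S ubar u j s) ξ‖ ^ 2‖) =
        fun ξ => ‖𝓕 (forcingDjC S ubar u j s) ξ‖ ^ 2 :=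
      funext fun ξ => Real.norm_of_nonneg (sq_nonneg _)
    rw [heq]
    exact (h.integral_norm_sq_fourier_forcingDjC_le j hs).2

/-- **Fubini**: `∫ dξ ∫_{(0,T)} ds ‖𝓕[(∂ⱼf)(s)_ℂ](ξ)‖² ≤ T · k (C(Kε)²)² |B_ρ|`. [folklore] -/
theorem SmallSol.integral_integral_le (h : SmallSol S ubar u T ρ K ε C r) (hT : 0 < T) (j : Fin d) :
    ∫ ξ, ∫ s in Ioo 0 T, ‖𝓕 (forcingDjC S ubar u j s) ξ‖ ^ 2 ≤
      T * (k * ((C * (K * ε) ^ 2) ^ 2 * volume.real (closedBall (0 : Space d) ρ))) := by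
  rw [integral_integral_swap (h.integrable_prod j)]
  have hb : ∀ s ∈ Ioo 0 T, ‖∫ ξ, ‖𝓕 (forcingDjC S ubar u j s) ξ‖ ^ 2‖ ≤
      k * ((C * (K * ε) ^ 2) ^ 2 * volume.real (closedBall (0 : Space d) ρ)) := fun s hs => by
    rw [Real.norm_of_nonneg (integral_nonneg fun _ => sq_nonneg _)]
    exact (h.integral_norm_sq_fourier_forcingDjC_le j hs).2
  have h1 := norm_setIntegral_le_of_norm_le_const
    (measure_Ioo_lt_top : (volume : Measure ℝ) (Ioo 0 T) < ⊤) hb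
  rw [Real.volume_real_Ioo_of_le hT.le, sub_zero] at h1
  rw [mul_comm T]
  exact (le_abs_self _).trans (by simpa [Real.norm_eq_abs] using h1)

/-- **The `L²(dξ)` bound**:
`∫ ‖2πiξⱼ Ŵ(T, ξ)‖² dξ ≤ K₁² T · T k (C(Kε)²)² |B_ρ|` (`K₁ = kC₀ · kC₀‖A₀⁻¹_ℂ‖`).
[cite: Rauch1986, Proof of Theorem pp. 482–483] -/
theorem SmallSol.integral_sq_norm_smul_remF_le (h : SmallSol S ubar u T ρ K ε C r)
    (hS : S.IsRauchClass ubar) (hu : S.IsClassicalSolution T u) (hT : 0 < T)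
    (h0 : ∀ x, u 0 x = ubar + ε • φ x)
    {C₀ : ℝ} (hC0 : 0 ≤ C₀) (hC₀ : ∀ t : ℝ, |t| ≤ T → ∀ (ξ : Space d) (a b : Fin k),
      ‖rauchSymbol (S.A0 ubar) (fun j => S.A j ubar) (fderiv ℝ S.B ubar) t ξ a b‖ ≤ C₀) (j : Fin d) :
    ∫ ξ : Space d, ‖(2 * Real.pi * ξ j * Complex.I) • remF S ubar u φ ε T ξ‖ ^ 2 ≤
      ((k * C₀) * ((k * C₀) * ‖((S.A0 ubar)⁻¹).map (algebraMap ℝ ℂ)‖)) ^ 2 * T *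
        (T * (k * ((C * (K * ε) ^ 2) ^ 2 * volume.real (closedBall (0 : Space d) ρ)))) := by
  set K₁ : ℝ := (k * C₀) * ((k * C₀) * ‖((S.A0 ubar)⁻¹).map (algebraMap ℝ ℂ)‖) with hK₁
  -- the dominating function, integrable by Fubini
  have hgi : Integrable fun ξ : Space d => (K₁ ^ 2 * T) *
      ∫ s in Ioo 0 T, ‖𝓕 (forcingDjC S ubar u j s) ξ‖ ^ 2 :=
    ((h.integrable_prod j).integral_prod_left).const_mul _
  -- pointwise comparison
  have hpt : ∀ ξ : Space d, ‖(2 * Real.pi * ξ j * Complex.I) • remF S ubar u φ ε T ξ‖ ^ 2 ≤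
      (K₁ ^ 2 * T) * ∫ s in Ioo 0 T, ‖𝓕 (forcingDjC S ubar u j s) ξ‖ ^ 2 := by
    intro ξ
    have h1 := h.sq_norm_smul_remF_le hS hu hT h0 hC0 hC₀ (2 * Real.pi * ξ j * Complex.I) ξ
    have heq : ∫ s in (0 : ℝ)..T, ‖(2 * Real.pi * ξ j * Complex.I) • 𝓕 (forcingC S ubar u s) ξ‖ ^ 2 =
        ∫ s in Ioo 0 T, ‖𝓕 (forcingDjC S ubar u j s) ξ‖ ^ 2 := by
      rw [intervalIntegral.integral_of_le hT.le, integral_Ioc_eq_integral_Ioo]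
      refine setIntegral_congr_fun measurableSet_Ioo fun s hs => ?_
      rw [h.fourier_forcingDjC_eq j hs ξ]
    rw [heq] at h1
    calc _ ≤ K₁ ^ 2 * (T * ∫ s in Ioo 0 T, ‖𝓕 (forcingDjC S ubar u j s) ξ‖ ^ 2) := h1
      _ = _ := by ring
  refine (integral_mono_of_nonneg (Eventually.of_forall fun ξ => sq_nonneg _) hgi
    (Eventually.of_forall hpt)).trans ?_
  rw [MeasureTheory.integral_const_mul]
  calc K₁ ^ 2 * T * ∫ ξ, ∫ s in Ioo 0 T, ‖𝓕 (forcingDjC S ubar u j s) ξ‖ ^ 2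
      ≤ K₁ ^ 2 * T * (T * (k * ((C * (K * ε) ^ 2) ^ 2 * volume.real (closedBall (0 : Space d) ρ)))) :=
        mul_le_mul_of_nonneg_left (h.integral_integral_le hT j) (by positivity)
    _ = _ := by rw [hK₁]

end Fubini

/-! ### Back to physical space: the remainder gradient at time `T` -/

section Physical

variable {S : QuasilinearSystem d k} {ubar : Fin k → ℝ} {u : ℝ → Space d → Fin k → ℝ}
  {T ρ K ε C r : ℝ} {φ : Space d → Fin k → ℝ}

variable (S ubar u) in
/-- **The remainder at time `T`**: `r(T) = u(T) - ū - εv(T)` with `v` the Fourier solution of the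
linearised system. [cite: Rauch1986, Proof of Theorem p. 482] -/
def remT (φ : Space d → Fin k → ℝ) (ε T : ℝ) (x : Space d) : Fin k → ℝ :=
  u T x - ubar - ε • fourierSolution (S.A0 ubar) (fun j => S.A j ubar) (fderiv ℝ S.B ubar) φ T x

/-- Slicing a `C¹` field on `ℝ × ℝᵈ` at a fixed time (stated for a free field `F`, so that the
composition elaborates structurally). [folklore] -/
theorem contDiff_slice_time {G : Type*} [NormedAddCommGroup G] [NormedSpace ℝ G]
    {F : ℝ × Space d → G} (hF : ContDiff ℝ 1 F) (T : ℝ) : ContDiff ℝ 1 fun x : Space d => F (T, x) :=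
  hF.comp (contDiff_prodMk_right T)

/-- The slices of the Fourier solution are `C¹`. [folklore] -/
theorem contDiff_fourierSolution_slice' {A₀ : Matrix (Fin k) (Fin k) ℝ}
    {A : Fin d → Matrix (Fin k) (Fin k) ℝ} {B₁ : (Fin k → ℝ) →L[ℝ] (Fin k → ℝ)}
    (hL : (ofConstant A₀ A B₁).IsRauchClass 0) (hφ : ContDiff ℝ ∞ φ) (hφc : HasCompactSupport φ)
    (T : ℝ) : ContDiff ℝ 1 fun x : Space d => fourierSolution A₀ A B₁ φ T x :=
  contDiff_slice_time (F := fun p : ℝ × Space d => fourierSolution A₀ A B₁ φ p.1 p.2)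
    (contDiff_one_fourierSolution hL hφ hφc) T

/-- The slice `v(T)` of the Fourier solution of the linearised system is `C¹`. [folklore] -/
theorem contDiff_fourierSolution_slice (hS : S.IsRauchClass ubar) (hφ : ContDiff ℝ ∞ φ)
    (hφc : HasCompactSupport φ) (T : ℝ) :
    ContDiff ℝ 1 (fourierSolution (S.A0 ubar) (fun j => S.A j ubar) (fderiv ℝ S.B ubar) φ T) :=
  contDiff_fourierSolution_slice' (A₀ := S.A0 ubar) (A := fun j => S.A j ubar)
    (B₁ := fderiv ℝ S.B ubar) hS.linearization hφ hφc T

/-- `r(T)` is `C¹`. [folklore] -/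
theorem contDiff_remT (hS : S.IsRauchClass ubar) (hu : S.IsClassicalSolution T u) (hT : 0 < T)
    (hφ : ContDiff ℝ ∞ φ) (hφc : HasCompactSupport φ) : ContDiff ℝ 1 (remT S ubar u φ ε T) :=
  ((hu.contDiff_slice ⟨hT.le, le_rfl⟩).sub contDiff_const).sub
    ((contDiff_fourierSolution_slice hS hφ hφc T).const_smul ε)

/-- `r(T)` vanishes outside a ball (of radius `max ρ (R + cT)`, `R` the support radius of `φ`,
`c` the propagation speed of the linearised system). [cite: Rauch1986, Proof of Theorem p. 482] -/
theorem exists_remT_eq_zero (hS : S.IsRauchClass ubar) (hT : 0 < T) (hφ : ContDiff ℝ ∞ φ)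
    (hφc : HasCompactSupport φ) (hsupp : ∀ t ∈ Icc 0 T, ∀ x : Space d, ρ < ‖x‖ → u t x = ubar) :
    ∃ ρ' : ℝ, ∀ x : Space d, ρ' < ‖x‖ → remT S ubar u φ ε T x = 0 := by
  obtain ⟨R, hR⟩ := exists_eq_zero_of_norm_gt hφc
  obtain ⟨c, -, hc⟩ := exists_speed_fourierSolution_eq_zero hS.linearization
  refine ⟨max ρ (R + c * T), fun x hx => ?_⟩
  have h1 : u T x = ubar := hsupp T ⟨hT.le, le_rfl⟩ x ((le_max_left _ _).trans_lt hx)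
  have h2 : fourierSolution (S.A0 ubar) (fun j => S.A j ubar) (fderiv ℝ S.B ubar) φ T x = 0 :=
    hc hT hφ hφc hR T ⟨hT.le, le_rfl⟩ x ((le_max_right _ _).trans_lt hx)
  rw [remT, h1, h2, sub_self, smul_zero, sub_zero]

/-- **The gradient of `r(T)`** is `∇u(T) - ε∇v(T)`. [folklore] -/
theorem fderiv_remT (hS : S.IsRauchClass ubar) (hu : S.IsClassicalSolution T u) (hT : 0 < T)
    (hφ : ContDiff ℝ ∞ φ) (hφc : HasCompactSupport φ) (x : Space d) :
    fderiv ℝ (remT S ubar u φ ε T) x = fderiv ℝ (u T) x -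
      ε • fderiv ℝ (fourierSolution (S.A0 ubar) (fun j => S.A j ubar) (fderiv ℝ S.B ubar) φ T) x := by
  have hu1 : DifferentiableAt ℝ (u T) x :=
    ((hu.contDiff_slice ⟨hT.le, le_rfl⟩).differentiable one_ne_zero).differentiableAt
  have hv1 : DifferentiableAt ℝ (fourierSolution (S.A0 ubar) (fun j => S.A j ubar) (fderiv ℝ S.B ubar) φ T) x :=
    ((contDiff_fourierSolution_slice hS hφ hφc T).differentiable one_ne_zero).differentiableAt
  have h : HasFDerivAt (fun y : Space d => u T y - ubar -
      ε • fourierSolution (S.A0 ubar) (fun j => S.A j ubar) (fderiv ℝ S.B ubar) φ T y)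
      (fderiv ℝ (u T) x -
        ε • fderiv ℝ (fourierSolution (S.A0 ubar) (fun j => S.A j ubar) (fderiv ℝ S.B ubar) φ T) x) x :=
    (hu1.hasFDerivAt.sub_const ubar).sub (hv1.hasFDerivAt.const_smul ε)
  exact h.fderiv

/-- **`𝓕[r(T)_ℂ] = Ŵ(T)`**: the Fourier transform of the remainder slice is the function bounded on
the Fourier side (`fourier_cplx_fourierSolution`: `𝓕[v(T)_ℂ] = M_T 𝓕φ_ℂ`).
[cite: Rauch1986, Proof of Theorem p. 483] -/
theorem fourier_cplx_remT (hS : S.IsRauchClass ubar) (hu : S.IsClassicalSolution T u) (hT : 0 < T)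
    (hφ : ContDiff ℝ ∞ φ) (hφc : HasCompactSupport φ)
    (hsupp : ∀ t ∈ Icc 0 T, ∀ x : Space d, ρ < ‖x‖ → u t x = ubar) (ξ : Space d) :
    𝓕 (cplx (remT S ubar u φ ε T)) ξ = remF S ubar u φ ε T ξ := by
  set v := fourierSolution (S.A0 ubar) (fun j => S.A j ubar) (fderiv ℝ S.B ubar) φ with hv
  have hTI : T ∈ Icc 0 T := ⟨hT.le, le_rfl⟩
  have hfun : cplx (remT S ubar u φ ε T) = fun x => devC ubar u T x - (ε : ℂ) • cplx (v T) x := by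
    funext x
    rw [cplx_apply, remT, map_sub, map_smul, devC, cplx_apply, cplx_apply, Complex.coe_smul]
  have h1i : Integrable (devC ubar u T) :=
    ((contDiffOn_uncurry_devC hu).continuousOn.comp_continuous
      (continuous_const.prodMk continuous_id) fun x => ⟨hTI, mem_univ x⟩ :).integrable_of_hasCompactSupport
      (by
        refine HasCompactSupport.intro (isCompact_closedBall (0 : Space d) ρ) fun x hx => ?_
        rw [mem_closedBall_zero_iff, not_le] at hx
        exact devC_eq_zero hsupp T hTI x hx)
  have hvc : ContDiff ℝ 1 (cplx (v T)) := (contDiff_fourierSolution_slice hS hφ hφc T).cplx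
  obtain ⟨R, hR⟩ := exists_eq_zero_of_norm_gt hφc
  obtain ⟨c, -, hc⟩ := exists_speed_fourierSolution_eq_zero hS.linearization
  have hvs : HasCompactSupport (cplx (v T)) := by
    refine HasCompactSupport.intro (isCompact_closedBall (0 : Space d) (R + c * T)) fun x hx => ?_
    rw [mem_closedBall_zero_iff, not_le] at hx
    have hz := hc hT hφ hφc hR T hTI x hx
    rw [← hv] at hz
    rw [cplx_apply, hz, map_zero]
  have h2i : Integrable fun x => (ε : ℂ) • cplx (v T) x :=
    Integrable.smul (ε : ℂ) (hvc.continuous.integrable_of_hasCompactSupport hvs)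
  rw [hfun, fourier_sub_apply h1i h2i, fourier_const_smul_apply,
    fourier_cplx_fourierSolution hS.linearization hT hφ hφc hTI ξ, remF]

/-- **Plancherel for the partial derivatives of `r(T)`**:
`∫ ‖∂ⱼr(T, x)‖² dx ≤ k ∫ ‖2πiξⱼ Ŵ(T, ξ)‖² dξ`. [cite: Titchmarsh1948, Thm. 48] -/
theorem integral_norm_sq_partial_remT_le (hS : S.IsRauchClass ubar) (hu : S.IsClassicalSolution T u)
    (hT : 0 < T) (hφ : ContDiff ℝ ∞ φ) (hφc : HasCompactSupport φ)
    (hsupp : ∀ t ∈ Icc 0 T, ∀ x : Space d, ρ < ‖x‖ → u t x = ubar) (j : Fin d) :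
    Integrable (fun x => ‖fderiv ℝ (remT S ubar u φ ε T) x (EuclideanSpace.single j 1)‖ ^ 2) ∧
      ∫ x, ‖fderiv ℝ (remT S ubar u φ ε T) x (EuclideanSpace.single j 1)‖ ^ 2 ≤
        k * ∫ ξ : Space d, ‖(2 * Real.pi * ξ j * Complex.I) • remF S ubar u φ ε T ξ‖ ^ 2 := by
  have hr : ContDiff ℝ 1 (remT S ubar u φ ε T) := contDiff_remT hS hu hT hφ hφc
  obtain ⟨ρ', hρ'⟩ := exists_remT_eq_zero (ε := ε) hS hT hφ hφc hsupp
  have hrc : HasCompactSupport (cplx (remT S ubar u φ ε T)) := by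
    refine HasCompactSupport.intro (isCompact_closedBall (0 : Space d) ρ') fun x hx => ?_
    rw [mem_closedBall_zero_iff, not_le] at hx
    rw [cplx_apply, hρ' x hx, map_zero]
  -- the complexified partial derivative
  set g : Space d → Fin k → ℂ := fun x => cplx (fun y => fderiv ℝ (remT S ubar u φ ε T) y
    (EuclideanSpace.single j 1)) x with hg
  have hgc : Continuous g :=
    ofRealPi.continuous.comp ((hr.continuous_fderiv one_ne_zero).clm_apply continuous_const)
  have hgs : HasCompactSupport g := by
    refine HasCompactSupport.intro (isCompact_closedBall (0 : Space d) ρ') fun x hx => ?_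
    rw [mem_closedBall_zero_iff, not_le] at hx
    rw [hg]
    dsimp only
    rw [cplx_apply, fderiv_eq_zero_of_eq_const_of_norm_gt hρ' hx, _root_.zero_apply, map_zero]
  have hgF : ∀ ξ, 𝓕 g ξ = (2 * Real.pi * ξ j * Complex.I) • remF S ubar u φ ε T ξ := by
    intro ξ
    have hfun : g = fun x => fderiv ℝ (cplx (remT S ubar u φ ε T)) x (EuclideanSpace.single j 1) := by
      funext x
      rw [hg]
      dsimp only
      rw [cplx_apply, fderiv_cplx_apply ((hr.differentiable one_ne_zero).differentiableAt)]
    rw [hfun, fourier_fderiv_apply_single hr.cplx hrc ξ j, fourier_cplx_remT hS hu hT hφ hφc hsupp ξ]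
  have hnorm : ∀ x, ‖fderiv ℝ (remT S ubar u φ ε T) x (EuclideanSpace.single j 1)‖ ^ 2 = ‖g x‖ ^ 2 := by
    intro x; rw [hg]; dsimp only; rw [cplx_apply, norm_ofRealPi]
  simp_rw [hnorm]
  refine ⟨integrable_norm_sq_of_hasCompactSupport hgc hgs, ?_⟩
  have h := integral_norm_sq_le_fourier hgc hgs
  simp_rw [hgF] at h
  exact h

/-- `‖L‖² ≤ d Σⱼ ‖L eⱼ‖²` for a linear map on `ℝᵈ`. [folklore] -/
theorem sq_opNorm_le_mul_sum_sq {F : Type*} [NormedAddCommGroup F] [NormedSpace ℝ F]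
    (L : Space d →L[ℝ] F) : ‖L‖ ^ 2 ≤ d * ∑ j, ‖L (EuclideanSpace.single j 1)‖ ^ 2 := by
  calc ‖L‖ ^ 2 ≤ (∑ j, ‖L (EuclideanSpace.single j 1)‖) ^ 2 :=
        pow_le_pow_left₀ (norm_nonneg _) (opNorm_le_sum_norm_apply_single L) 2
    _ ≤ (Finset.univ : Finset (Fin d)).card * ∑ j, ‖L (EuclideanSpace.single j 1)‖ ^ 2 :=
        sq_sum_le_card_mul_sum_sq
    _ = d * ∑ j, ‖L (EuclideanSpace.single j 1)‖ ^ 2 := by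
        rw [Finset.card_univ, Fintype.card_fin]

/-- **The `L²` bound for the remainder gradient** `∇ₓr(T) = ∇ₓu(T) - ε∇ₓv(T)`: it is square
integrable and `∫ ‖∇ₓu(T) - ε∇ₓv(T)‖² ≤ d · Σⱼ k · ∫ ‖2πiξⱼ Ŵ(T, ξ)‖² dξ`, hence, by the
Fourier-side bound, `O(ε⁴)`. [cite: Rauch1986, Proof of Theorem p. 482] -/
theorem SmallSol.integral_norm_fderiv_sub_sq_le (h : SmallSol S ubar u T ρ K ε C r)
    (hS : S.IsRauchClass ubar) (hu : S.IsClassicalSolution T u) (hT : 0 < T)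
    (hφ : ContDiff ℝ ∞ φ) (hφc : HasCompactSupport φ) (h0 : ∀ x, u 0 x = ubar + ε • φ x)
    {C₀ : ℝ} (hC0 : 0 ≤ C₀) (hC₀ : ∀ t : ℝ, |t| ≤ T → ∀ (ξ : Space d) (a b : Fin k),
      ‖rauchSymbol (S.A0 ubar) (fun j => S.A j ubar) (fderiv ℝ S.B ubar) t ξ a b‖ ≤ C₀) :
    Integrable (fun x => ‖fderiv ℝ (u T) x -
      ε • fderiv ℝ (fourierSolution (S.A0 ubar) (fun j => S.A j ubar) (fderiv ℝ S.B ubar) φ T) x‖ ^ 2) ∧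
    ∫ x, ‖fderiv ℝ (u T) x -
        ε • fderiv ℝ (fourierSolution (S.A0 ubar) (fun j => S.A j ubar) (fderiv ℝ S.B ubar) φ T) x‖ ^ 2 ≤
      d * (d * (k * (((k * C₀) * ((k * C₀) * ‖((S.A0 ubar)⁻¹).map (algebraMap ℝ ℂ)‖)) ^ 2 * T *
        (T * (k * ((C * (K * ε) ^ 2) ^ 2 * volume.real (closedBall (0 : Space d) ρ))))))) := by
  have hfd : ∀ x, fderiv ℝ (u T) x -
      ε • fderiv ℝ (fourierSolution (S.A0 ubar) (fun j => S.A j ubar) (fderiv ℝ S.B ubar) φ T) x =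
        fderiv ℝ (remT S ubar u φ ε T) x := fun x => (fderiv_remT hS hu hT hφ hφc x).symm
  simp_rw [hfd]
  have hr : ContDiff ℝ 1 (remT S ubar u φ ε T) := contDiff_remT hS hu hT hφ hφc
  obtain ⟨ρ', hρ'⟩ := exists_remT_eq_zero (ε := ε) hS hT hφ hφc h.supp
  -- integrability of the squared gradient (continuous, compactly supported)
  have hcont : Continuous fun x => ‖fderiv ℝ (remT S ubar u φ ε T) x‖ ^ 2 :=
    (hr.continuous_fderiv one_ne_zero).norm.pow 2
  have hint : Integrable fun x => ‖fderiv ℝ (remT S ubar u φ ε T) x‖ ^ 2 := by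
    refine hcont.integrable_of_hasCompactSupport ?_
    refine HasCompactSupport.intro (isCompact_closedBall (0 : Space d) ρ') fun x hx => ?_
    rw [mem_closedBall_zero_iff, not_le] at hx
    rw [fderiv_eq_zero_of_eq_const_of_norm_gt hρ' hx, norm_zero]
    norm_num
  refine ⟨hint, ?_⟩
  -- the partial derivatives
  have hj := fun j => integral_norm_sq_partial_remT_le (ε := ε) hS hu hT hφ hφc h.supp j
  have hsum : Integrable fun x => (d : ℝ) * ∑ j, ‖fderiv ℝ (remT S ubar u φ ε T) x
      (EuclideanSpace.single j 1)‖ ^ 2 :=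
    (integrable_finsetSum _ fun j _ => (hj j).1).const_mul _
  calc ∫ x, ‖fderiv ℝ (remT S ubar u φ ε T) x‖ ^ 2
      ≤ ∫ x, (d : ℝ) * ∑ j, ‖fderiv ℝ (remT S ubar u φ ε T) x (EuclideanSpace.single j 1)‖ ^ 2 :=
        integral_mono hint hsum fun x => sq_opNorm_le_mul_sum_sq _
    _ = d * ∑ j, ∫ x, ‖fderiv ℝ (remT S ubar u φ ε T) x (EuclideanSpace.single j 1)‖ ^ 2 := by
        rw [MeasureTheory.integral_const_mul, integral_finsetSum _ fun j _ => (hj j).1]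
    _ ≤ d * ∑ _j : Fin d, k * (((k * C₀) * ((k * C₀) * ‖((S.A0 ubar)⁻¹).map (algebraMap ℝ ℂ)‖)) ^ 2 * T *
          (T * (k * ((C * (K * ε) ^ 2) ^ 2 * volume.real (closedBall (0 : Space d) ρ))))) := by
        refine mul_le_mul_of_nonneg_left (Finset.sum_le_sum fun j _ => ?_) (Nat.cast_nonneg d)
        exact (hj j).2.trans (mul_le_mul_of_nonneg_left
          (h.integral_sq_norm_smul_remF_le hS hu hT h0 hC0 hC₀ j) (Nat.cast_nonneg k))
    _ = _ := by rw [Finset.sum_const, Finset.card_univ, Fintype.card_fin, nsmul_eq_mul]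

end Physical

/-! ### Assembly: Rauch's `L²` expansion from small classical solutions -/

section Assembly

variable {S : QuasilinearSystem d k} {ubar : Fin k → ℝ}

/-- **Rauch's `L²` small-amplitude expansion for one system, one time and one datum, from small
classical solutions.** If `S` is in Rauch's class at `ū`, `T > 0`, `φ ∈ C_c^∞`, and for all
sufficiently small `ε > 0` there are classical solutions `u_ε` of (1) on `[0, T]` with data
`ū + εφ`, `C²` on the closed slab, equal to `ū` for `‖x‖ > ρ`, with
`‖u_ε - ū‖, ‖Du_ε‖, ‖D²u_ε‖ ≤ Kε` at interior times, then with `v` the Fourier solution of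
the linearised system: `v` is a classical solution of `S.linearization ū` on `[0, T]` with
`v(0) = φ`, and `∫ ‖∇ₓu_ε(T) - ε∇ₓv(T)‖² ≤ Cε⁴` for all small `ε > 0`.
[cite: Rauch1986, Local Existence Theorem and Proof of Theorem p. 482] -/
theorem smallAmplitudeExpansionL2_of_smallSolutions (hS : S.IsRauchClass ubar) {T : ℝ} (hT : 0 < T)
    {φ : Space d → Fin k → ℝ} (hφ : ContDiff ℝ ∞ φ) (hφc : HasCompactSupport φ)
    (hsol : ∃ (u : ℝ → ℝ → Space d → Fin k → ℝ) (ρ K : ℝ), ∀ᶠ ε in 𝓝[>] (0 : ℝ),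
      S.IsClassicalSolution T (u ε) ∧ (∀ x, u ε 0 x = ubar + ε • φ x) ∧
      ContDiffOn ℝ 2 (Function.uncurry (u ε)) (Icc 0 T ×ˢ univ) ∧
      (∀ t ∈ Icc 0 T, ∀ x : Space d, ρ < ‖x‖ → u ε t x = ubar) ∧
      (∀ p : ℝ × Space d, p.1 ∈ Ioo 0 T → ‖u ε p.1 p.2 - ubar‖ ≤ K * ε ∧
        ‖fderiv ℝ (Function.uncurry (u ε)) p‖ ≤ K * ε ∧
        ‖fderiv ℝ (fun q => fderiv ℝ (Function.uncurry (u ε)) q) p‖ ≤ K * ε)) :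
    ∃ v : ℝ → Space d → Fin k → ℝ,
      (S.linearization ubar).IsClassicalSolution T v ∧ (∀ x, v 0 x = φ x) ∧
      ∃ (u : ℝ → ℝ → Space d → Fin k → ℝ) (C : ℝ), ∀ᶠ ε in 𝓝[>] (0 : ℝ),
        S.IsClassicalSolution T (u ε) ∧ (∀ x, u ε 0 x = ubar + ε • φ x) ∧
        Integrable (fun x => ‖fderiv ℝ (u ε T) x - ε • fderiv ℝ (v T) x‖ ^ 2) ∧
        ∫ x, ‖fderiv ℝ (u ε T) x - ε • fderiv ℝ (v T) x‖ ^ 2 ≤ C * ε ^ 4 := by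
  obtain ⟨u, ρ, K, hev⟩ := hsol
  set v := fourierSolution (S.A0 ubar) (fun j => S.A j ubar) (fderiv ℝ S.B ubar) φ with hv
  refine ⟨v, isClassicalSolution_fourierSolution hS.linearization hT hφ hφc,
    fun x => fourierSolution_zero hφ hφc x, u, ?_⟩
  -- the quadratic bounds for `Φ` and Brenner's bound for the symbol
  obtain ⟨CΦ, r, hCΦ, hr, hΦ⟩ := exists_quadratic_bounds_of_fderiv_zero
    (contDiff_infty.1 (contDiff_remainderMap (S := S) (ubar := ubar)) 2)
    (remainderMap_zero S ubar) hasFDerivAt_remainderMap_zero.fderiv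
  obtain ⟨C₀, hC0, hC₀⟩ := exists_symbolBound hS.linearization T
  refine ⟨d * (d * (k * (((k * C₀) * ((k * C₀) * ‖((S.A0 ubar)⁻¹).map (algebraMap ℝ ℂ)‖)) ^ 2 * T *
    (T * (k * ((CΦ * K ^ 2) ^ 2 * volume.real (closedBall (0 : Space d) ρ))))))), ?_⟩
  -- `Kε ≤ r` for small `ε`
  have hsmall : ∀ᶠ ε in 𝓝[>] (0 : ℝ), K * ε < r := by
    have ht : Tendsto (fun ε : ℝ => K * ε) (𝓝[>] (0 : ℝ)) (𝓝 (K * 0)) :=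
      ((continuous_const.mul continuous_id).tendsto 0).mono_left nhdsWithin_le_nhds
    rw [mul_zero] at ht
    exact ht (Iio_mem_nhds hr)
  filter_upwards [hev, hsmall, self_mem_nhdsWithin] with ε ⟨hsolε, hdata, h2, hsup, hb⟩ hKr hpos
  have hε : 0 < ε := hpos
  -- `0 ≤ Kε` from the bound at an interior point
  have hKε : 0 ≤ K * ε := (norm_nonneg _).trans (hb (T / 2, 0) ⟨by linarith, by linarith⟩).1
  have hSS : SmallSol S ubar (u ε) T ρ K ε CΦ r :=
    { contDiffOn := h2
      supp := hsup
      Kε_nonneg := hKε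
      C_nonneg := hCΦ
      quad := hΦ
      Kε_le := hKr.le
      b0 := fun p hp => (hb p hp).1
      b1 := fun p hp => (hb p hp).2.1
      b2 := fun p hp => (hb p hp).2.2 }
  obtain ⟨hint, hle⟩ := hSS.integral_norm_fderiv_sub_sq_le hS hsolε hT hφ hφc hdata hC0 hC₀
  refine ⟨hsolε, hdata, hint, hle.trans_eq ?_⟩
  ring

/-- **`Rauch1986_smallAmplitudeExpansionL2` from small classical solutions**: the named fact
follows from the pure existence-with-bounds statement — for every system in Rauch's class at
`ū`, every `T > 0` and `φ ∈ C_c^∞`, classical solutions `u_ε` on `[0, T]` with data `ū + εφ` for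
all small `ε > 0`, `C²` on the slab, equal to `ū` off a fixed ball, `O(ε)`-close to `ū` in `C²`
(the Local Existence Theorem [Rauch1986, p. 482] with its uniform `Hˢ` bounds and finite
propagation speed). [cite: Rauch1986, Local Existence Theorem and Proof of Theorem p. 482] -/
theorem Rauch1986_smallAmplitudeExpansionL2_of_smallSolutions
    (hQ : ∀ ⦃d k : ℕ⦄ (S : QuasilinearSystem d k) (ubar : Fin k → ℝ), S.IsRauchClass ubar →
      ∀ ⦃T : ℝ⦄, 0 < T → ∀ φ : Space d → Fin k → ℝ, ContDiff ℝ ∞ φ → HasCompactSupport φ →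
        ∃ (u : ℝ → ℝ → Space d → Fin k → ℝ) (ρ K : ℝ), ∀ᶠ ε in 𝓝[>] (0 : ℝ),
          S.IsClassicalSolution T (u ε) ∧ (∀ x, u ε 0 x = ubar + ε • φ x) ∧
          ContDiffOn ℝ 2 (Function.uncurry (u ε)) (Icc 0 T ×ˢ univ) ∧
          (∀ t ∈ Icc 0 T, ∀ x : Space d, ρ < ‖x‖ → u ε t x = ubar) ∧
          (∀ p : ℝ × Space d, p.1 ∈ Ioo 0 T → ‖u ε p.1 p.2 - ubar‖ ≤ K * ε ∧
            ‖fderiv ℝ (Function.uncurry (u ε)) p‖ ≤ K * ε ∧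
            ‖fderiv ℝ (fun q => fderiv ℝ (Function.uncurry (u ε)) q) p‖ ≤ K * ε)) :
    Rauch1986_smallAmplitudeExpansionL2 :=
  fun _ _ S ubar hS _ hT φ hφ hφc =>
    smallAmplitudeExpansionL2_of_smallSolutions hS hT hφ hφc (hQ S ubar hS hT φ hφ hφc)

end Assembly

end Literature.Barriers.AtomisticToContinuum

end
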